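import Mathlib

/-!
# LINE 16 — the NON-CONFINEMENT LAW for seed carriers of `BlochSeedDiscOne` (crux `stmt-HodgeConjecture-18881`)

STATUS.  Nothing in this file proves or refutes HC, HC_CM, HC_AV, `BlochSeedDiscOne` (= H2 of route 18879, item 18881) or any census
row; `HC_CM` is never used.  This is a crux WORKFILE (evidence for the line card `Ideas/non-confinement-law.md`): a decidable letter-level
SHADOW of a pencil theorem about the carrier `Z` of STUB R's seed, plus kernel-checked instances on census supports of record.
Lens: negation — ASSUME the seed of `stub_rung_pad4_seedAt` exists (`HasBlochSeedAt 4 (pad4Anchor E₀) h w`: an integral, Bloch-semiregular,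
regularly immersed fourfold `Z ⊂ P = (E₀ × E₀)⁴` with `q·h⁴ + w` supported on `Z`, `w ≠ 0` a rational Weil class); WHERE can `Z` sit?

## The pencil theorem (proved in the card, §The law; NOT formalised here — Hodge theory of abelian varieties is not in the tree)

**THEOREM NC (non-confinement).**  Let `λ = q·h⁴ + w ∈ H⁸(P, ℚ)`, `w ∈ W_K = Λ⁸V₊ ⊕ Λ⁸V₋` (`weilClassesOf … 4 1`), be the class of an
integral fourfold `Z ⊂ P` (so `q ≠ 0`: `w ∪ h⁴ = 0` by bidegree while `deg_h Z > 0`).  Then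
(NC₁) for every surjective homomorphism `π : P → B`, `dim B ≥ 1`, the image `π(Z)` has dimension `≥ 2` (Z lies in no fibre and over no curve);
(NC₂) for every pair of factors `{f, g}`, `π_{fg}(Z) = S_f × S_g` (Z dominates every factor pair; equivalently `Z ⊄ π_{fg}⁻¹(D)` for any
proper closed `D`).  Proof (card): `Z ⊂ π⁻¹(D)` with `dim D = d` kills `[Z] ∪ π^*γ` for all `γ ∈ H^{2d+1}(B)` (restriction through `H^{2d+1}(D) = 0`
+ projection formula); in the `ψ`-eigen-bigrading `h ∈ (1,1)`, `w ∈ (8,0) ⊕ (0,8)`, and for `2d+1 ≤ 3` (resp. `B = S_f × S_g`, `2d+1 = 7`, `γ` of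
bidegree `(4,3)+(3,4)`) the products `h⁴ ∪ π^*γ` and `w ∪ π^*γ` live in DISJOINT bidegrees, so `q·h⁴ ∪ π^*γ = 0`; but `h⁴ ∪ (·)` is injective on
`H^{≤4}(P)` (hard Lefschetz) resp. on `π^*H⁷(S_f × S_g)` (Künneth with the fibre `K = S_{f'} × S_{g'}`, `(h|_K)⁴ ≠ 0`) — so `q = 0`, contradiction.
(The bidegree bookkeeping is `noCollision₃` ∕ `noCollision₇` below.)

**COROLLARY Q (designs).**  If `Z = Z(s)`, `s` a regular section of a rank-4 bundle `E` on `P`, then `E` has NO torsion-free rank-1 quotient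
pulled back from a quotient `B` of `P` with `dim B ≤ 2`, and none pulled back from a factor pair `S_f × S_g`: the image section is `0` (then `s`
lives in a corank-1 subsheaf and `Z` is empty or confined) or a pull-back `π^*σ` (Birkenhake–Lange: sections of bundles pulled back along a
surjective homomorphism with connected kernel are pulled back), and then `Z ⊂ π⁻¹(Z(σ) ∪ W)` — confined, contradicting NC.

**DOWNSET LAW (two-level ⊕-line-bundle designs `0 → 𝓟 → 𝓝 → E → 0`, census dictionary `Pad4FirstOrderModel`: E = COKERNEL, lower
cells = `𝓝`-constituents, upper cells = `𝓟`-constituents, entries `H⁰(N_Y ⊗ P_W⁻¹) ≠ 0` only for `W ≤ Y` in the psd order).**  For every pair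
`{f,g}` and every ORDER IDEAL `I` of cells supported on `{f,g}` (letter `O` on the other two factors) the block `𝓟_I → 𝓝_I` is generically
surjective (its cokernel `F_I` is a quotient of `E` pulled back from `S_f × S_g`; rank `F_I ≥ 1` would give a forbidden rank-1 quotient).  Shadows:
(B1) `m(𝓟 ∩ I) ≥ m(𝓝 ∩ I)` with multiplicity — `Support.Heavy`; (B2) MATCHING: every lower cell supported on ≤ 2 factors has an upper cell
STRICTLY below it — `Support.MatchingLaw` (support-level, Horn clauses `N_Y → ∨_{W<Y} P_W`); (B3) Hall's condition on every sub-family.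
The same holds for every order ideal of cells of Hermitian rank ≤ 2 (quotients of dimension ≤ 2, NC₁), which (B2) already contains
(`twoFactor_of_hrank_le_two`).

## What is IN LEAN here (all `decide` ∕ elementary; 0 `sorry`, no new axioms)
§0 verbatim copies of LINE 15's letter∕cell∕support vocabulary; §1 the psd order `lle`/`cle`/`clt` on letters/cells, factor support `nz`, `TwoFactor`, `OnPair`; order lemmas (`lle_trans`, downward closure of
`OnPair` and of `nz`, `not_clt_zero`: nothing lies strictly below the zero cell; `twoFactor_of_hrank_le_two`).
§2 the law's shadows as decidable predicates on `Support`: `Matched`, `MatchingLaw`, `Heavy`, `PrincipalHeavy`, and the two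
structural consequences: `matchingLaw_no_zeroCell` (the law CONTAINS «¬N[O⁴]», LINE 15 p5 ∕ AUDIT (c)) and `forcedShape` (LINE 15 + LINE 16:
a diag-leak support obeying the law has an UPPER two-factor cell strictly below a leak cell).
`zeroCell_clt` ∕ `matchingLaw_of_upper_zeroCell` (honesty: an upper zero cell `𝒪 ∈ 𝓟` absorbs (B2); the content is then in (B1)∕(B3)).
§3 the bidegree bookkeeping of NC (`noCollision₃`, `noCollision₇`).
§4 census instances: the factor-pair ideal `{2,3}` of the j305149 r1 `core_only` and `full` minus-A2I⁻ witnesses typed literally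
(66∕48 and 105∕71 cells): MATCHING holds except at `N[O⁴]`, unit-multiplicity (B1) FAILS (pair counts 66 > 48, 105 > 71; principal downsets of the
16 rank-1 ray cells 2 > 1); the design-of-record fragment `c8Fragment` has NO two-factor cell (law vacuous — it is leak-free, LINE 15; the digit table says the same of every design of record).

§5 (rev 1.1) the RAY LEMMA (`Letter.sq_eq_of_lle_null`, `Letter.ray_of_lle_null`: a psd letter below a null letter is null-or-zero on the same ray — equality
case of Cauchy–Schwarz in `ℤ²`), `Letter.hrank_le_of_lle` ∕ `Cell.hrank_le_of_cle` (Hermitian rank is MONOTONE in the psd order), `Support.forcedShape'`.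
§6 (rev 1.2) BIDEGREE SEPARATION over an arbitrary `ℕ × ℕ`-graded commutative `ℂ`-algebra (Mathlib `GradedAlgebra`): `bidegree_separation`
(`q • h4·γ + (wp + wm)·γ = 0 ⇒ q • h4·γ = 0` for `h4 ∈ (4,4)`, `wp ∈ (8,0)`, `wm ∈ (0,8)`, `γ` in total degree `≤ 3`), `q_eq_zero_of_bidegree_separation`,
`weil_pairs_zero` — the independence step of NC is now kernel; the Hodge-theoretic inputs (bigrading of `H^*(P;ℂ)`, bidegrees of `h`, `w`, hard Lefschetz ∕ Künneth) stay pencil.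
§7 (rev 1.3, critic p3) the MULTIPLICITY-LEVEL row: `Support.HeavyM mN mP I` (linear in the design multiplicities; an upper zero cell is counted in every ideal
automatically), `heavy_iff_heavyM_one` (§2's `Heavy` = unit case), `HeavyM.mono`, `upper_mass_of_heavyM`, `r1CorePair23_upper_mass` (≥ 66 upper mass on 48 cells);
§7′ (rev 1.4, riders t1–t3 of idea-crit-hsem-2 g5) support-relative primed versions (`HeavyM.mono'`, `upper_mass_of_heavyM'`, `r1CorePair23_upper_mass'`),
the convention sentence, and the zero-cell term (`zeroCell_cle`, `onPair_zeroCell`, `Support.zeroCell_mass_le{,_pair,_principal}`).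
§8 (rev 1.5) GENERAL POSITION LAW NC₃ — census shadow: `Covered`, `covered_of_twoFactor`, `MatchingLawGP` (⇒ `MatchingLaw`), ray∕ideal vocabulary `InRay`, `FR`, `FRR`
(order ideals: `inRay_of_lle`, `FR_of_cle`, `FRR_of_cle`), instances `r1CoreFR01` (19∕14), `r1CoreFRR012` (49∕30, 13 + 4 three-factor cells) with `decide`d censuses.
§9 (rev 1.6) FOUR-RAY BALANCE DICHOTOMY NC₄ and the LOCK LAW — census shadow: `Cell.FourRay`, Gaussian phase product `Cell.betaProd`∕`Cell.alphaProd`,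
`Cell.InLockClass`, `CoveredL` (⊇ `Covered`), `MatchingLawL` (⇒ `MatchingLawGP`), instance `r1CoreFourRay` (the 52 uncovered core cells: ALL in lock class `ζ* = 1`),
the pair-consistency ⟺ balance identity `balance_iff` and the universal lock ratios `64∕35`, `99∕35` as exact arithmetic; rev 1.7 `balance_normalForm`
(NC₄ for every `ψ`-invariant `h`); rev 1.8 `nc5_unique_complement` (the one-monomial heart of NC₅, equivariant-curve separation for EVERY quotient touching `P_A` or `P_B`);
rev 1.9 NC₆ (transverse quotients of dimension 2, 3 dominated) and the COMPLETE POSITION THEOREM, both in the §9 docstring (pencil; no new declarations).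

## What is NOT here
NC ∕ Q ∕ the DOWNSET LAW themselves (pencil, in the card), any statement about `HasBlochSeedAt`, any SAT∕LP verdict, (Z1)∕(Z2), multiplicities
other than list repetition, Pic⁰-twisted (`(F4)`-limb) realisations, non-`ψ`-linear quotients of dimension ≥ 3.  No `instance` beyond
`Decidable`, no notation, no named fact.
-/

set_option linter.dupNamespace false
set_option linter.style.longLine false
set_option maxRecDepth 20000

namespace Summit.HodgeConjecture.HodgeConjecture.Cruxes.BlochSeedDiscOne.NonConfinementLaw

/-! ## §0 Letters, cells, supports — VERBATIM copies of `InjELeakLaw` §1∕§3∕§4 (LINE 15 kernel, rev 1.1 b1f86481fd84c9d2)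

Copied (not imported) so that this workfile elaborates stand-alone on the farm; the definitions agree word for word, so every statement below
reads identically over LINE 15's `Support`s. -/

/-- A balanced letter `(α, Re β, Im β)`: the Hermitian block `[[α, β], [β̄, α]]` of a line-bundle class on one factor `E × E`. -/
abbrev Letter := ℤ × ℤ × ℤ

/-- A cell = one ⊠-line-bundle constituent: a letter on each of the four factors. -/
abbrev Cell := Fin 4 → Letter

namespace Letter

/-- `α`. -/
def a (x : Letter) : ℤ := x.1
/-- `|β|²`. -/
def s (x : Letter) : ℤ := x.2.1 * x.2.1 + x.2.2 * x.2.2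
/-- difference of classes. -/
def sub (x y : Letter) : Letter := (x.1 - y.1, x.2.1 - y.2.1, x.2.2 - y.2.2)
/-- positive semidefinite block: `α ≥ 0` and `α² ≥ |β|²`. -/
def Psd (x : Letter) : Prop := 0 ≤ x.a ∧ x.s ≤ x.a * x.a

instance (x : Letter) : Decidable x.Psd := by unfold Psd; infer_instance

/-- Hermitian rank of the block `[[α, β], [β̄, α]]`: `0` for the zero letter, `1` if `α² = |β|² ≠ 0`, else `2`. -/
def hrank (x : Letter) : ℕ :=
  if x.1 = 0 ∧ x.2.1 = 0 ∧ x.2.2 = 0 then 0 else if x.a * x.a = x.s then 1 else 2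

end Letter

namespace Cell

/-- pointwise difference of cells (class of `L ⊗ M^∨`). -/
def sub (X Y : Cell) : Cell := fun f => (X f).sub (Y f)
/-- Hermitian rank of the cell = sum over the four factors. -/
def hrank (X : Cell) : ℕ := (X 0).hrank + (X 1).hrank + (X 2).hrank + (X 3).hrank
/-- psd cell: every letter psd. -/
def Psd (X : Cell) : Prop := (X 0).Psd ∧ (X 1).Psd ∧ (X 2).Psd ∧ (X 3).Psd

instance (X : Cell) : Decidable X.Psd := by unfold Psd; infer_instance

end Cell

/-- A two-level support: lower cells (`𝓝`-constituents) and upper cells (`𝓟`-constituents), as lists of cells (repetition = multiplicity). -/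
structure Support where
  lower : List Cell
  upper : List Cell

/-- `DiagLeak S`: some lower cell has Hermitian rank ≤ 2 (LINE 15: a diagonal leak cell, `H²(P, −Y) ≠ 0` possible). -/
def Support.DiagLeak (S : Support) : Prop := ∃ Y ∈ S.lower, Y.hrank ≤ 2

instance (S : Support) : Decidable S.DiagLeak := by unfold Support.DiagLeak; infer_instance

/-- cell builder (letters `(α, Re β, Im β)` on factors 0–3, as `Pad4TowerCrossPhase.mcellOf`). -/
def cellOf (l0 l1 l2 l3 : Letter) : Cell := ![l0, l1, l2, l3]

/-- the zero letter `O`, the floor letters `4ℓ_ζ` and the ray letters `3ℓ_ζ` for the four phases `ζ ∈ {1, i, −1, −i}`. -/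
def O : Letter := (0, 0, 0)
/-- see `O`. -/
def fl4 (k : Fin 4) : Letter := ![(4, 4, 0), (4, 0, 4), (4, -4, 0), (4, 0, -4)] k

/-- the rank-1 LOWER orbit `N[O|O|O|4ℓ_ζ]` (16 cells: charged factor × phase) of the j305149 r1 `core_only`∕`odd_fc` minus-A2I⁻ witnesses. -/
def rank1Orbit : List Cell :=
  (List.finRange 4).flatMap fun f => (List.finRange 4).map fun k => Function.update (fun _ => O) f (fl4 k)

/-- LINE 15's floor-hung toy support `{N[O|O|O|4ℓ₁], N[ℓ₁]⁴ ; P[O|O|O|3ℓ₁]}`. -/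
def toyFloor : Support where
  lower := [cellOf O O O (4, 4, 0), cellOf (1, 1, 0) (1, 1, 0) (1, 1, 0) (1, 1, 0)]
  upper := [cellOf O O O (3, 3, 0)]

/-- LINE 15's ◇₈ ceiling fragment (`Pad4TowerLineDesignCert8`): letters `8I`, `6I+ℓ_{−ζ}`, `4I+2ℓ_ζ`; 48 lower cells charged on two factors with
`8I` on the other two, and the upper unit cell `[6I+ℓ₋₁]⁴`. -/
def e8 : Letter := (8, 0, 0)
/-- see `e8`. -/
def u7 (k : Fin 4) : Letter := ![(7, -1, 0), (7, 0, -1), (7, 1, 0), (7, 0, 1)] k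
/-- see `e8`. -/
def v6 (k : Fin 4) : Letter := ![(6, 2, 0), (6, 0, 2), (6, -2, 0), (6, 0, -2)] k

/-- see `e8`. -/
def c8Orbit : List Cell :=
  (List.finRange 4).flatMap fun i => (List.finRange 4).flatMap fun j =>
    if i = j then [] else (List.finRange 4).map fun k =>
      Function.update (Function.update (fun _ => e8) i (u7 k)) j (v6 k)

/-- see `e8`. -/
def c8Fragment : Support where
  lower := c8Orbit
  upper := [cellOf (7, -1, 0) (7, -1, 0) (7, -1, 0) (7, -1, 0)]

/-! ## §1 The psd (Loewner) order on letters and cells; factor support -/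

/-- `x ≤ y` in the psd order: `y − x` is a psd letter (so `H⁰(N_Y ⊗ P_W⁻¹)` can be non-zero only if `W ≤ Y`, factorwise). -/
def lle (x y : Letter) : Prop := (y.sub x).Psd

instance (x y : Letter) : Decidable (lle x y) := by unfold lle; infer_instance

/-- `W ≤ Y` for cells: factorwise psd order. -/
def cle (W Y : Cell) : Prop := (Y.sub W).Psd

instance (W Y : Cell) : Decidable (cle W Y) := by unfold cle; infer_instance

/-- `W < Y`: `W ≤ Y` and `W ≠ Y` (a `Minimal` design has no isomorphism entries, so a matching entry is strict). -/
def clt (W Y : Cell) : Prop := cle W Y ∧ W ≠ Y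

instance (W Y : Cell) : Decidable (clt W Y) := by unfold clt; infer_instance

/-- the set of factors on which the cell is not the zero letter. -/
def nz (X : Cell) : Finset (Fin 4) := Finset.univ.filter fun f => X f ≠ O

/-- supported on at most two factors (pulled back from some `S_f × S_g`). -/
def TwoFactor (X : Cell) : Prop := (nz X).card ≤ 2

instance (X : Cell) : Decidable (TwoFactor X) := by unfold TwoFactor; infer_instance

/-- supported on the factor pair `{f, g}`. -/
def OnPair (f g : Fin 4) (X : Cell) : Prop := ∀ k : Fin 4, k ≠ f → k ≠ g → X k = O

instance (f g : Fin 4) (X : Cell) : Decidable (OnPair f g X) := by unfold OnPair; infer_instance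

theorem lle_refl (x : Letter) : lle x x := by
  unfold lle Letter.Psd Letter.sub Letter.a Letter.s; simp

/-- a psd letter below the zero letter is zero. -/
theorem eq_O_of_psd_of_lle_O (w : Letter) (hw : w.Psd) (h : lle w O) : w = O := by
  obtain ⟨a, b, c⟩ := w
  simp only [lle, Letter.Psd, Letter.sub, Letter.a, Letter.s, O] at hw h
  have ha : a = 0 := by omega
  subst ha
  have hb : b * b = 0 := by nlinarith [mul_self_nonneg b, mul_self_nonneg c]
  have hc : c * c = 0 := by nlinarith [mul_self_nonneg b, mul_self_nonneg c]
  simp [mul_self_eq_zero.mp hb, mul_self_eq_zero.mp hc, O]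

/-- transitivity of the psd order on letters (sum of psd letters is psd: Cauchy–Schwarz in `ℤ²`). -/
theorem lle_trans {x y z : Letter} (h₁ : lle x y) (h₂ : lle y z) : lle x z := by
  obtain ⟨a₁, b₁, c₁⟩ := x; obtain ⟨a₂, b₂, c₂⟩ := y; obtain ⟨a₃, b₃, c₃⟩ := z
  simp only [lle, Letter.Psd, Letter.sub, Letter.a, Letter.s] at h₁ h₂ ⊢
  obtain ⟨p₁, q₁⟩ := h₁; obtain ⟨p₂, q₂⟩ := h₂
  refine ⟨by omega, ?_⟩
  -- with u = y - x, v = z - y (both psd): |β_u + β_v|² ≤ (a_u + a_v)² since β_u·β_v ≤ a_u a_v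
  have key : (b₂ - b₁) * (b₃ - b₂) + (c₂ - c₁) * (c₃ - c₂) ≤ (a₂ - a₁) * (a₃ - a₂) := by
    have hsq : ((b₂ - b₁) * (b₃ - b₂) + (c₂ - c₁) * (c₃ - c₂)) * ((b₂ - b₁) * (b₃ - b₂) + (c₂ - c₁) * (c₃ - c₂))
        ≤ ((a₂ - a₁) * (a₃ - a₂)) * ((a₂ - a₁) * (a₃ - a₂)) := by
      nlinarith [mul_self_nonneg ((b₂ - b₁) * (c₃ - c₂) - (c₂ - c₁) * (b₃ - b₂)), mul_nonneg p₁ p₂,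
        mul_le_mul q₁ q₂ (by nlinarith [mul_self_nonneg (b₃ - b₂), mul_self_nonneg (c₃ - c₂)]) (mul_self_nonneg (a₂ - a₁))]
    nlinarith [hsq, mul_nonneg p₁ p₂]
  nlinarith [key]

theorem cle_refl (X : Cell) : cle X X := by
  unfold cle Cell.Psd Cell.sub; exact ⟨lle_refl _, lle_refl _, lle_refl _, lle_refl _⟩

theorem cle_trans {W X Y : Cell} (h₁ : cle W X) (h₂ : cle X Y) : cle W Y := by
  unfold cle Cell.Psd Cell.sub at *
  exact ⟨lle_trans h₁.1 h₂.1, lle_trans h₁.2.1 h₂.2.1, lle_trans h₁.2.2.1 h₂.2.2.1, lle_trans h₁.2.2.2 h₂.2.2.2⟩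

/-- the factorwise components of `cle`. -/
theorem lle_of_cle {W Y : Cell} (h : cle W Y) (f : Fin 4) : lle (W f) (Y f) := by
  unfold cle Cell.Psd Cell.sub at h
  fin_cases f
  · exact h.1
  · exact h.2.1
  · exact h.2.2.1
  · exact h.2.2.2

theorem psd_apply {W : Cell} (h : W.Psd) (f : Fin 4) : (W f).Psd := by
  unfold Cell.Psd at h
  fin_cases f
  · exact h.1
  · exact h.2.1
  · exact h.2.2.1
  · exact h.2.2.2

/-- downward closure of the factor support: a psd cell below `Y` vanishes wherever `Y` does. -/
theorem nz_subset_of_cle {W Y : Cell} (hW : W.Psd) (h : cle W Y) : nz W ⊆ nz Y := by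
  intro f hf
  simp only [nz, Finset.mem_filter, Finset.mem_univ, true_and] at hf ⊢
  intro hY
  apply hf
  have h1 := lle_of_cle h f
  rw [hY] at h1
  exact eq_O_of_psd_of_lle_O _ (psd_apply hW f) h1

/-- two-factor cells form an order ideal (among psd cells). -/
theorem twoFactor_of_cle {W Y : Cell} (hW : W.Psd) (h : cle W Y) (hY : TwoFactor Y) : TwoFactor W :=
  le_trans (Finset.card_le_card (nz_subset_of_cle hW h)) hY

/-- the cells on a fixed factor pair form an order ideal (among psd cells). -/
theorem onPair_of_cle {f g : Fin 4} {W Y : Cell} (hW : W.Psd) (h : cle W Y) (hY : OnPair f g Y) : OnPair f g W := by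
  intro k hk hk'
  by_contra hne
  have hk2 : k ∈ nz W := by simp [nz, hne]
  have := nz_subset_of_cle hW h hk2
  simp [nz, hY k hk hk'] at this

/-- the zero cell. -/
def zeroCell : Cell := fun _ => O

theorem zeroCell_eq : zeroCell = cellOf O O O O := by
  funext f; fin_cases f <;> rfl

/-- NOTHING lies strictly below the zero cell: a psd `W ≤ O⁴` is `O⁴`.  (So the zero lower cell can never be matched: the law contains
«¬N[O⁴]», LINE 15 p5 ∕ the section convention `E ↠ 𝒪 ⇒ Z = ∅`.) -/
theorem not_clt_zeroCell (W : Cell) (hW : W.Psd) : ¬ clt W zeroCell := by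
  rintro ⟨hle, hne⟩
  apply hne
  funext f
  exact eq_O_of_psd_of_lle_O _ (psd_apply hW f) (lle_of_cle hle f)

/-- a non-zero letter has Hermitian rank ≥ 1. -/
theorem one_le_hrank_of_ne_O (x : Letter) (hx : x ≠ O) : 1 ≤ x.hrank := by
  obtain ⟨a, b, c⟩ := x
  unfold Letter.hrank
  split_ifs with h0
  · exact absurd (by obtain ⟨rfl, rfl, rfl⟩ := h0; rfl) hx
  all_goals omega

/-- a cell of Hermitian rank ≤ 2 is supported on ≤ 2 factors: the hrank-≤2 downsets of NC₁ are inside the two-factor downsets of NC₂. -/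
theorem twoFactor_of_hrank_le_two (X : Cell) (h : X.hrank ≤ 2) : TwoFactor X := by
  unfold TwoFactor nz
  have key : ∀ f : Fin 4, (if X f ≠ O then 1 else 0) ≤ (X f).hrank := by
    intro f
    split_ifs with hf
    · exact one_le_hrank_of_ne_O _ hf
    · exact Nat.zero_le _
  rw [Finset.card_filter]
  have h0 := key 0; have h1 := key 1; have h2 := key 2; have h3 := key 3
  simp only [Fin.sum_univ_four]
  unfold Cell.hrank at h
  omega

/-! ## §2 The law's shadows on a two-level support (lists with repetition = multiplicities) -/

namespace Support

/-- `Y` is MATCHED in `S`: some upper cell lies strictly below it (a column of the `𝓟_I → 𝓝_I` block can hit the row `Y`). -/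
def Matched (S : Support) (Y : Cell) : Prop := ∃ W ∈ S.upper, clt W Y

instance (S : Support) (Y : Cell) : Decidable (S.Matched Y) := by unfold Matched; infer_instance

/-- (B2) the MATCHING LAW: every lower cell supported on ≤ 2 factors is matched from strictly below. -/
def MatchingLaw (S : Support) : Prop := ∀ Y ∈ S.lower, TwoFactor Y → S.Matched Y

instance (S : Support) : Decidable S.MatchingLaw := by unfold MatchingLaw; infer_instance

/-- (B1) bottom-heaviness of the ideal cut out by a predicate `I`: at least as many upper as lower cells in `I` (with multiplicity). -/
def Heavy (S : Support) (I : Cell → Prop) [DecidablePred I] : Prop := S.lower.countP (fun X => decide (I X)) ≤ S.upper.countP (fun X => decide (I X))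

instance (S : Support) (I : Cell → Prop) [DecidablePred I] : Decidable (S.Heavy I) := by unfold Heavy; infer_instance

/-- (B1) on every factor-pair ideal `{[x|y] on {f,g}}`. -/
def PairHeavy (S : Support) : Prop := ∀ f g : Fin 4, f < g → S.Heavy (OnPair f g)

instance (S : Support) : Decidable S.PairHeavy := by unfold PairHeavy Heavy; infer_instance

/-- (B1) on every principal downset `↓Y` of a two-factor lower cell `Y`. -/
def PrincipalHeavy (S : Support) : Prop := ∀ Y ∈ S.lower, TwoFactor Y → S.Heavy (fun X => cle X Y)

instance (S : Support) : Decidable S.PrincipalHeavy := by unfold PrincipalHeavy Heavy; infer_instance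

/-- no two-factor cell on either level: the law is vacuous (every design of record, §4). -/
def TwoFactorFree (S : Support) : Prop := (∀ Y ∈ S.lower, ¬ TwoFactor Y) ∧ (∀ W ∈ S.upper, ¬ TwoFactor W)

instance (S : Support) : Decidable S.TwoFactorFree := by unfold TwoFactorFree; infer_instance

theorem matchingLaw_of_twoFactorFree (S : Support) (h : S.TwoFactorFree) : S.MatchingLaw :=
  fun Y hY h2 => absurd h2 (h.1 Y hY)

theorem principalHeavy_of_twoFactorFree (S : Support) (h : S.TwoFactorFree) : S.PrincipalHeavy :=
  fun Y hY h2 => absurd h2 (h.1 Y hY)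

/-- THE LAW CONTAINS «¬N[O⁴]»: a support with psd upper cells obeying the matching law has no zero lower cell. -/
theorem matchingLaw_no_zeroCell (S : Support) (hU : ∀ W ∈ S.upper, W.Psd) (h : S.MatchingLaw) : zeroCell ∉ S.lower := by
  intro hz
  obtain ⟨W, hW, hlt⟩ := h zeroCell hz (by decide)
  exact not_clt_zeroCell W (hU W hW) hlt

/-- HONESTY LEMMA: the zero cell lies strictly below every non-zero psd cell — so ONE upper zero cell `P[O⁴] = 𝒪 ∈ 𝓟` (if the universe admits it; no witness
or design of record has one) satisfies (B2) for every lower cell at once; the law's content then sits entirely in the multiplicity rows (B1)∕(B3), where `𝒪`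
counts in EVERY ideal (`m_𝒪 + Σ_{𝓟'∩I} m ≥ Σ_{𝓝∩I} m`). -/
theorem zeroCell_clt (Y : Cell) (hY : Y.Psd) (h : Y ≠ zeroCell) : clt zeroCell Y := by
  refine ⟨?_, fun e => h e.symm⟩
  unfold cle Cell.Psd Cell.sub
  have key : ∀ f, lle (zeroCell f) (Y f) := by
    intro f
    have hf := psd_apply hY f
    generalize hy : Y f = y at hf ⊢
    obtain ⟨a, b, c⟩ := y
    simp only [lle, Letter.Psd, Letter.sub, Letter.a, Letter.s, zeroCell, O, sub_zero] at hf ⊢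
    exact hf
  exact ⟨key 0, key 1, key 2, key 3⟩

theorem matchingLaw_of_upper_zeroCell (S : Support) (hz : zeroCell ∈ S.upper) (hL : ∀ Y ∈ S.lower, Y.Psd) (hnz : zeroCell ∉ S.lower) :
    S.MatchingLaw :=
  fun Y hY _ => ⟨zeroCell, hz, zeroCell_clt Y (hL Y hY) (fun e => hnz (e ▸ hY))⟩

/-- monotonicity in the upper level / antitonicity in the lower level (more columns, fewer rows keep the matching). -/
theorem MatchingLaw.mono {S T : Support} (hl : T.lower ⊆ S.lower) (hu : S.upper ⊆ T.upper) (h : S.MatchingLaw) : T.MatchingLaw := by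
  intro Y hY h2
  obtain ⟨W, hW, hlt⟩ := h Y (hl hY) h2
  exact ⟨W, hu hW, hlt⟩

/-- FORCED SHAPE (LINE 15 + LINE 16).  A support in the leak room through a diagonal leak cell (`DiagLeak`: a lower cell of Hermitian rank ≤ 2 —
the only way to beat the diagonal criterion virtually, `InjELeakLaw` (L6)) that obeys the matching law carries an UPPER cell supported on ≤ 2
factors strictly below that leak cell: the census-invisible carrier's design has a `𝓟`-constituent pulled back from a surface `S_f × S_g`-factor pair. -/
theorem forcedShape (S : Support) (hU : ∀ W ∈ S.upper, W.Psd) (hleak : S.DiagLeak) (hlaw : S.MatchingLaw) :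
    ∃ Y ∈ S.lower, ∃ W ∈ S.upper, Y.hrank ≤ 2 ∧ clt W Y ∧ TwoFactor W := by
  obtain ⟨Y, hY, hr⟩ := hleak
  obtain ⟨W, hW, hlt⟩ := hlaw Y hY (twoFactor_of_hrank_le_two Y hr)
  exact ⟨Y, hY, W, hW, hr, hlt, twoFactor_of_cle (hU W hW) hlt.1 (twoFactor_of_hrank_le_two Y hr)⟩

end Support

/-! ## §3 The bidegree bookkeeping of THEOREM NC

In the `ψ`-eigen-bigrading of `H^•(P, ℂ) = Λ^•(V₊ ⊕ V₋)` (`dim V_± = 8`): `h⁴ ∈ (4,4)`, `w ∈ (8,0) ⊕ (0,8)`, `π^*γ ∈ ⊕ (a,b)`.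
`w ∪ π^*γ` lands in `(8+a, b) ⊕ (a, 8+b)` — non-zero only through the components `a = 0` resp. `b = 0`, and then in bidegrees `(8, k)`, `(k, 8)`;
`h⁴ ∪ π^*γ` lands in `(4+a, 4+b)`.  The two never meet when `a + b ≤ 3` (NC₁) and, for `γ ∈ π_{fg}^* H⁷(S_f × S_g)` (`a, b ≤ 4`, `a + b = 7`),
`γ` has no `(0,7)`∕`(7,0)` part at all (NC₂).  So `[Z] ∪ π^*γ = 0` splits into `q·(h⁴ ∪ π^*γ) = 0` AND `w ∪ π^*γ = 0`. -/

theorem noCollision₃ (a b k : ℕ) (h : a + b ≤ 3) : (4 + a, 4 + b) ≠ (8, k) ∧ (4 + a, 4 + b) ≠ (k, 8) := by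
  constructor <;> simp only [ne_eq, Prod.mk.injEq, not_and] <;> omega

theorem noCollision₇ (a b : ℕ) (ha : a ≤ 4) (hb : b ≤ 4) (h : a + b = 7) : a ≠ 0 ∧ b ≠ 0 ∧ (4 + a ≠ 8 ∨ 4 + b ≠ 8) := by omega

/-! ## §4 Census instances (supports of record; cells transcribed from the cited files) -/

/-- the 16 upper ray cells `P[O|O|O|3ℓ_ζ]` (charged factor × phase) of the r1 `core_only`∕`odd_fc` witnesses: the ONLY cells strictly below the
rank-1 lower orbit `N[O|O|O|4ℓ_ζ]` there. -/
def fl3 (k : Fin 4) : Letter := ![(3, 3, 0), (3, 0, 3), (3, -3, 0), (3, 0, -3)] k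

/-- see `fl3`. -/
def ray3Orbit : List Cell :=
  (List.finRange 4).flatMap fun f => (List.finRange 4).map fun k => Function.update (fun _ => O) f (fl3 k)

/-- the RAY FRAGMENT of the r1 `core_only` witness: lower `N[O⁴]` + the rank-1 orbit (17 cells), upper the 16 ray cells `P[…3ℓ_ζ…]`. -/
def r1Ray : Support where
  lower := zeroCell :: rank1Orbit
  upper := ray3Orbit

/-- Kernel check on the ray fragment: every rank-1 lower cell IS matched (by `P[3ℓ_ζ]` on its ray — RULE-D service survives in the witness),
the zero cell is NOT; unit-multiplicity (B1) FAILS on each principal downset `↓N[O|O|O|4ℓ_ζ] = {N[O⁴], N[4ℓ_ζ]} ⊔ {P[3ℓ_ζ]}` (2 > 1) — the 16+1 = 17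
principal violations of the digit table — and holds again once the zero cell is removed. -/
theorem r1Ray_matching : (∀ Y ∈ rank1Orbit, r1Ray.Matched Y) ∧ ¬ r1Ray.Matched zeroCell ∧ ¬ r1Ray.MatchingLaw := by decide

theorem r1Ray_principal : ¬ r1Ray.PrincipalHeavy ∧ (Support.mk rank1Orbit ray3Orbit).PrincipalHeavy ∧ (Support.mk rank1Orbit ray3Orbit).MatchingLaw := by
  decide

/-- the factor-pair-{2,3} ideal of the j305149 r1 `core_only` minus-A2I⁻ witness: ALL its cells `[O|O|x|y]` (lower 66, upper 48;
transcribed from `witness-famcore-core_only-minus-A2Im-kissat.json` via the `mcellOf` tables of LINE 15, tool `matchlaw.py` 09a8b71bde4a7546). -/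
def r1CorePair23 : Support where
  lower := [cellOf O O O O,
    cellOf O O O (4, 4, 0),
    cellOf O O O (4, 0, 4),
    cellOf O O O (4, -4, 0),
    cellOf O O O (4, 0, -4),
    cellOf O O (1, 1, 0) (3, 3, 0),
    cellOf O O (1, 1, 0) (3, 0, 3),
    cellOf O O (1, 1, 0) (3, -3, 0),
    cellOf O O (1, 1, 0) (3, 0, -3),
    cellOf O O (1, 0, 1) (3, 3, 0),
    cellOf O O (1, 0, 1) (3, 0, 3),
    cellOf O O (1, 0, 1) (3, -3, 0),
    cellOf O O (1, 0, 1) (3, 0, -3),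
    cellOf O O (1, -1, 0) (3, 3, 0),
    cellOf O O (1, -1, 0) (3, 0, 3),
    cellOf O O (1, -1, 0) (3, -3, 0),
    cellOf O O (1, -1, 0) (3, 0, -3),
    cellOf O O (1, 0, -1) (3, 3, 0),
    cellOf O O (1, 0, -1) (3, 0, 3),
    cellOf O O (1, 0, -1) (3, -3, 0),
    cellOf O O (1, 0, -1) (3, 0, -3),
    cellOf O O (2, 2, 0) (2, 2, 0),
    cellOf O O (2, 2, 0) (2, 0, 2),
    cellOf O O (2, 2, 0) (2, -2, 0),
    cellOf O O (2, 2, 0) (2, 0, -2),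
    cellOf O O (2, 2, 0) (2, 0, 0),
    cellOf O O (2, 0, 2) (2, 2, 0),
    cellOf O O (2, 0, 2) (2, 0, 2),
    cellOf O O (2, 0, 2) (2, -2, 0),
    cellOf O O (2, 0, 2) (2, 0, -2),
    cellOf O O (2, 0, 2) (2, 0, 0),
    cellOf O O (2, -2, 0) (2, 2, 0),
    cellOf O O (2, -2, 0) (2, 0, 2),
    cellOf O O (2, -2, 0) (2, -2, 0),
    cellOf O O (2, -2, 0) (2, 0, -2),
    cellOf O O (2, -2, 0) (2, 0, 0),
    cellOf O O (2, 0, -2) (2, 2, 0),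
    cellOf O O (2, 0, -2) (2, 0, 2),
    cellOf O O (2, 0, -2) (2, -2, 0),
    cellOf O O (2, 0, -2) (2, 0, -2),
    cellOf O O (2, 0, -2) (2, 0, 0),
    cellOf O O (3, 3, 0) (1, 1, 0),
    cellOf O O (3, 3, 0) (1, 0, 1),
    cellOf O O (3, 3, 0) (1, -1, 0),
    cellOf O O (3, 3, 0) (1, 0, -1),
    cellOf O O (3, 0, 3) (1, 1, 0),
    cellOf O O (3, 0, 3) (1, 0, 1),
    cellOf O O (3, 0, 3) (1, -1, 0),
    cellOf O O (3, 0, 3) (1, 0, -1),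
    cellOf O O (3, -3, 0) (1, 1, 0),
    cellOf O O (3, -3, 0) (1, 0, 1),
    cellOf O O (3, -3, 0) (1, -1, 0),
    cellOf O O (3, -3, 0) (1, 0, -1),
    cellOf O O (3, 0, -3) (1, 1, 0),
    cellOf O O (3, 0, -3) (1, 0, 1),
    cellOf O O (3, 0, -3) (1, -1, 0),
    cellOf O O (3, 0, -3) (1, 0, -1),
    cellOf O O (4, 4, 0) O,
    cellOf O O (4, 0, 4) O,
    cellOf O O (4, -4, 0) O,
    cellOf O O (4, 0, -4) O,
    cellOf O O (2, 0, 0) (2, 2, 0),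
    cellOf O O (2, 0, 0) (2, 0, 2),
    cellOf O O (2, 0, 0) (2, -2, 0),
    cellOf O O (2, 0, 0) (2, 0, -2),
    cellOf O O (2, 0, 0) (2, 0, 0)]
  upper := [cellOf O O O (3, 3, 0),
    cellOf O O O (3, 0, 3),
    cellOf O O O (3, -3, 0),
    cellOf O O O (3, 0, -3),
    cellOf O O (1, 1, 0) (2, 2, 0),
    cellOf O O (1, 1, 0) (2, 0, 2),
    cellOf O O (1, 1, 0) (2, -2, 0),
    cellOf O O (1, 1, 0) (2, 0, -2),
    cellOf O O (1, 1, 0) (2, 0, 0),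
    cellOf O O (1, 0, 1) (2, 2, 0),
    cellOf O O (1, 0, 1) (2, 0, 2),
    cellOf O O (1, 0, 1) (2, -2, 0),
    cellOf O O (1, 0, 1) (2, 0, -2),
    cellOf O O (1, 0, 1) (2, 0, 0),
    cellOf O O (1, -1, 0) (2, 2, 0),
    cellOf O O (1, -1, 0) (2, 0, 2),
    cellOf O O (1, -1, 0) (2, -2, 0),
    cellOf O O (1, -1, 0) (2, 0, -2),
    cellOf O O (1, -1, 0) (2, 0, 0),
    cellOf O O (1, 0, -1) (2, 2, 0),
    cellOf O O (1, 0, -1) (2, 0, 2),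
    cellOf O O (1, 0, -1) (2, -2, 0),
    cellOf O O (1, 0, -1) (2, 0, -2),
    cellOf O O (1, 0, -1) (2, 0, 0),
    cellOf O O (2, 2, 0) (1, 1, 0),
    cellOf O O (2, 2, 0) (1, 0, 1),
    cellOf O O (2, 2, 0) (1, -1, 0),
    cellOf O O (2, 2, 0) (1, 0, -1),
    cellOf O O (2, 0, 2) (1, 1, 0),
    cellOf O O (2, 0, 2) (1, 0, 1),
    cellOf O O (2, 0, 2) (1, -1, 0),
    cellOf O O (2, 0, 2) (1, 0, -1),
    cellOf O O (2, -2, 0) (1, 1, 0),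
    cellOf O O (2, -2, 0) (1, 0, 1),
    cellOf O O (2, -2, 0) (1, -1, 0),
    cellOf O O (2, -2, 0) (1, 0, -1),
    cellOf O O (2, 0, -2) (1, 1, 0),
    cellOf O O (2, 0, -2) (1, 0, 1),
    cellOf O O (2, 0, -2) (1, -1, 0),
    cellOf O O (2, 0, -2) (1, 0, -1),
    cellOf O O (3, 3, 0) O,
    cellOf O O (3, 0, 3) O,
    cellOf O O (3, -3, 0) O,
    cellOf O O (3, 0, -3) O,
    cellOf O O (2, 0, 0) (1, 1, 0),
    cellOf O O (2, 0, 0) (1, 0, 1),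
    cellOf O O (2, 0, 0) (1, -1, 0),
    cellOf O O (2, 0, 0) (1, 0, -1)]

/-- the factor-pair-{2,3} ideal of the j305149 r1 `full` minus-A2I⁻ witness: ALL its cells `[O|O|x|y]` (lower 105, upper 71;
transcribed from `witness-famcore-full-minus-A2Im-kissat.json` via the `mcellOf` tables of LINE 15, tool `matchlaw.py` 09a8b71bde4a7546). -/
def r1FullPair23 : Support where
  lower := [cellOf O O O O,
    cellOf O O (1, 1, 0) (4, 4, 0),
    cellOf O O (1, 1, 0) (4, 0, 4),
    cellOf O O (1, 1, 0) (4, 2, 0),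
    cellOf O O (1, 1, 0) (4, 0, 2),
    cellOf O O (1, 1, 0) (4, 0, 0),
    cellOf O O (1, 0, 1) (4, 0, 4),
    cellOf O O (1, 0, 1) (4, -4, 0),
    cellOf O O (1, 0, 1) (4, 0, 2),
    cellOf O O (1, 0, 1) (4, -2, 0),
    cellOf O O (1, 0, 1) (4, 0, 0),
    cellOf O O (1, -1, 0) (4, -4, 0),
    cellOf O O (1, -1, 0) (4, 0, -4),
    cellOf O O (1, -1, 0) (4, -2, 0),
    cellOf O O (1, -1, 0) (4, 0, -2),
    cellOf O O (1, -1, 0) (4, 0, 0),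
    cellOf O O (1, 0, -1) (4, 4, 0),
    cellOf O O (1, 0, -1) (4, 0, -4),
    cellOf O O (1, 0, -1) (4, 2, 0),
    cellOf O O (1, 0, -1) (4, 0, -2),
    cellOf O O (1, 0, -1) (4, 0, 0),
    cellOf O O (2, 2, 0) (3, 3, 0),
    cellOf O O (2, 2, 0) (3, 0, 3),
    cellOf O O (2, 2, 0) (4, 0, -4),
    cellOf O O (2, 2, 0) (3, 1, 0),
    cellOf O O (2, 2, 0) (3, 0, 1),
    cellOf O O (2, 2, 0) (4, 0, 0),
    cellOf O O (2, 0, 2) (3, 0, 3),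
    cellOf O O (2, 0, 2) (3, -3, 0),
    cellOf O O (2, 0, 2) (4, 4, 0),
    cellOf O O (2, 0, 2) (3, 0, 1),
    cellOf O O (2, 0, 2) (3, -1, 0),
    cellOf O O (2, 0, 2) (4, 0, 0),
    cellOf O O (2, -2, 0) (3, -3, 0),
    cellOf O O (2, -2, 0) (3, 0, -3),
    cellOf O O (2, -2, 0) (4, 0, 4),
    cellOf O O (2, -2, 0) (3, -1, 0),
    cellOf O O (2, -2, 0) (3, 0, -1),
    cellOf O O (2, -2, 0) (4, 0, 0),
    cellOf O O (2, 0, -2) (3, 3, 0),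
    cellOf O O (2, 0, -2) (3, 0, -3),
    cellOf O O (2, 0, -2) (4, -4, 0),
    cellOf O O (2, 0, -2) (3, 1, 0),
    cellOf O O (2, 0, -2) (3, 0, -1),
    cellOf O O (2, 0, -2) (4, 0, 0),
    cellOf O O (3, 3, 0) (2, 2, 0),
    cellOf O O (3, 3, 0) (2, 0, -2),
    cellOf O O (3, 3, 0) (2, 0, 0),
    cellOf O O (3, 0, 3) (2, 2, 0),
    cellOf O O (3, 0, 3) (2, 0, 2),
    cellOf O O (3, 0, 3) (2, 0, 0),
    cellOf O O (3, -3, 0) (2, 0, 2),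
    cellOf O O (3, -3, 0) (2, -2, 0),
    cellOf O O (3, -3, 0) (2, 0, 0),
    cellOf O O (3, 0, -3) (2, -2, 0),
    cellOf O O (3, 0, -3) (2, 0, -2),
    cellOf O O (3, 0, -3) (2, 0, 0),
    cellOf O O (4, 4, 0) (1, 1, 0),
    cellOf O O (4, 4, 0) (1, 0, -1),
    cellOf O O (4, 4, 0) (2, 0, 2),
    cellOf O O (4, 0, 4) (1, 1, 0),
    cellOf O O (4, 0, 4) (1, 0, 1),
    cellOf O O (4, 0, 4) (2, -2, 0),
    cellOf O O (4, -4, 0) (1, 0, 1),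
    cellOf O O (4, -4, 0) (1, -1, 0),
    cellOf O O (4, -4, 0) (2, 0, -2),
    cellOf O O (4, 0, -4) (1, -1, 0),
    cellOf O O (4, 0, -4) (1, 0, -1),
    cellOf O O (4, 0, -4) (2, 2, 0),
    cellOf O O (2, 0, 0) (3, 3, 0),
    cellOf O O (2, 0, 0) (3, 0, 3),
    cellOf O O (2, 0, 0) (3, -3, 0),
    cellOf O O (2, 0, 0) (3, 0, -3),
    cellOf O O (2, 0, 0) (3, 1, 0),
    cellOf O O (2, 0, 0) (3, 0, 1),
    cellOf O O (2, 0, 0) (3, -1, 0),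
    cellOf O O (2, 0, 0) (3, 0, -1),
    cellOf O O (3, 1, 0) (2, 2, 0),
    cellOf O O (3, 1, 0) (2, 0, -2),
    cellOf O O (3, 1, 0) (2, 0, 0),
    cellOf O O (3, 0, 1) (2, 2, 0),
    cellOf O O (3, 0, 1) (2, 0, 2),
    cellOf O O (3, 0, 1) (2, 0, 0),
    cellOf O O (3, -1, 0) (2, 0, 2),
    cellOf O O (3, -1, 0) (2, -2, 0),
    cellOf O O (3, -1, 0) (2, 0, 0),
    cellOf O O (3, 0, -1) (2, -2, 0),
    cellOf O O (3, 0, -1) (2, 0, -2),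
    cellOf O O (3, 0, -1) (2, 0, 0),
    cellOf O O (4, 2, 0) (1, 1, 0),
    cellOf O O (4, 2, 0) (1, 0, -1),
    cellOf O O (4, 0, 2) (1, 1, 0),
    cellOf O O (4, 0, 2) (1, 0, 1),
    cellOf O O (4, -2, 0) (1, 0, 1),
    cellOf O O (4, -2, 0) (1, -1, 0),
    cellOf O O (4, 0, -2) (1, -1, 0),
    cellOf O O (4, 0, -2) (1, 0, -1),
    cellOf O O (4, 0, 0) (1, 1, 0),
    cellOf O O (4, 0, 0) (1, 0, 1),
    cellOf O O (4, 0, 0) (1, -1, 0),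
    cellOf O O (4, 0, 0) (1, 0, -1),
    cellOf O O (4, 0, 0) (2, 2, 0),
    cellOf O O (4, 0, 0) (2, 0, 2),
    cellOf O O (4, 0, 0) (2, -2, 0),
    cellOf O O (4, 0, 0) (2, 0, -2)]
  upper := [cellOf O O O (4, 4, 0),
    cellOf O O O (4, 0, 4),
    cellOf O O O (4, -4, 0),
    cellOf O O O (4, 0, -4),
    cellOf O O O (4, 2, 0),
    cellOf O O O (4, 0, 2),
    cellOf O O O (4, -2, 0),
    cellOf O O O (4, 0, -2),
    cellOf O O O (4, 0, 0),
    cellOf O O (1, 1, 0) (3, 3, 0),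
    cellOf O O (1, 1, 0) (3, 0, 3),
    cellOf O O (1, 1, 0) (3, 1, 0),
    cellOf O O (1, 1, 0) (3, 0, 1),
    cellOf O O (1, 0, 1) (3, 0, 3),
    cellOf O O (1, 0, 1) (3, -3, 0),
    cellOf O O (1, 0, 1) (3, 0, 1),
    cellOf O O (1, 0, 1) (3, -1, 0),
    cellOf O O (1, -1, 0) (3, -3, 0),
    cellOf O O (1, -1, 0) (3, 0, -3),
    cellOf O O (1, -1, 0) (3, -1, 0),
    cellOf O O (1, -1, 0) (3, 0, -1),
    cellOf O O (1, 0, -1) (3, 3, 0),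
    cellOf O O (1, 0, -1) (3, 0, -3),
    cellOf O O (1, 0, -1) (3, 1, 0),
    cellOf O O (1, 0, -1) (3, 0, -1),
    cellOf O O (2, 2, 0) (2, 2, 0),
    cellOf O O (2, 2, 0) (2, 0, 2),
    cellOf O O (2, 2, 0) (2, 0, -2),
    cellOf O O (2, 2, 0) (2, 0, 0),
    cellOf O O (2, 0, 2) (2, 2, 0),
    cellOf O O (2, 0, 2) (2, 0, 2),
    cellOf O O (2, 0, 2) (2, -2, 0),
    cellOf O O (2, 0, 2) (2, 0, 0),
    cellOf O O (2, -2, 0) (2, 0, 2),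
    cellOf O O (2, -2, 0) (2, -2, 0),
    cellOf O O (2, -2, 0) (2, 0, -2),
    cellOf O O (2, -2, 0) (2, 0, 0),
    cellOf O O (2, 0, -2) (2, 2, 0),
    cellOf O O (2, 0, -2) (2, -2, 0),
    cellOf O O (2, 0, -2) (2, 0, -2),
    cellOf O O (2, 0, -2) (2, 0, 0),
    cellOf O O (3, 3, 0) (1, 1, 0),
    cellOf O O (3, 3, 0) (1, 0, -1),
    cellOf O O (3, 0, 3) (1, 1, 0),
    cellOf O O (3, 0, 3) (1, 0, 1),
    cellOf O O (3, -3, 0) (1, 0, 1),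
    cellOf O O (3, -3, 0) (1, -1, 0),
    cellOf O O (3, 0, -3) (1, -1, 0),
    cellOf O O (3, 0, -3) (1, 0, -1),
    cellOf O O (4, 4, 0) O,
    cellOf O O (4, 0, 4) O,
    cellOf O O (4, -4, 0) O,
    cellOf O O (4, 0, -4) O,
    cellOf O O (2, 0, 0) (2, 2, 0),
    cellOf O O (2, 0, 0) (2, 0, 2),
    cellOf O O (2, 0, 0) (2, -2, 0),
    cellOf O O (2, 0, 0) (2, 0, -2),
    cellOf O O (2, 0, 0) (2, 0, 0),
    cellOf O O (3, 1, 0) (1, 1, 0),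
    cellOf O O (3, 1, 0) (1, 0, -1),
    cellOf O O (3, 0, 1) (1, 1, 0),
    cellOf O O (3, 0, 1) (1, 0, 1),
    cellOf O O (3, -1, 0) (1, 0, 1),
    cellOf O O (3, -1, 0) (1, -1, 0),
    cellOf O O (3, 0, -1) (1, -1, 0),
    cellOf O O (3, 0, -1) (1, 0, -1),
    cellOf O O (4, 2, 0) O,
    cellOf O O (4, 0, 2) O,
    cellOf O O (4, -2, 0) O,
    cellOf O O (4, 0, -2) O,
    cellOf O O (4, 0, 0) O]

theorem r1CorePair23_sizes : r1CorePair23.lower.length = 66 ∧ r1CorePair23.upper.length = 48 := by decide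

/-- all cells of the pair ideal are psd and supported on `{2,3}`; lower Hermitian ranks `{0:1, 1:8, 2:48, 3:8, 4:1}`, upper `{1:8, 2:32, 3:8}`. -/
theorem r1CorePair23_wellFormed :
    (∀ X ∈ r1CorePair23.lower ++ r1CorePair23.upper, X.Psd ∧ OnPair 2 3 X) ∧
    (r1CorePair23.lower.map Cell.hrank).count 2 = 48 ∧ (r1CorePair23.lower.map Cell.hrank).count 3 = 8 ∧
    (r1CorePair23.lower.map Cell.hrank).count 4 = 1 ∧ (r1CorePair23.upper.map Cell.hrank).count 2 = 32 := by
  decide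

/-- CENSUS INSTANCE (j305149 r1 `core_only` minus-A2I⁻, pair `{2,3}`): (B2) MATCHING holds at every lower cell except the zero cell (65∕66 —
the support-level bite on a RULE-D-closed witness is exactly «¬N[O⁴]»), while unit-multiplicity (B1) FAILS on the whole pair ideal: 66 > 48
(Hall deficiency 18; the other five pairs are `G₁`-images).  A seed design on this support needs `P`-multiplicities ≥ 2 on two-factor upper cells. -/
theorem r1CorePair23_census :
    (∀ Y ∈ r1CorePair23.lower, Y ≠ zeroCell → r1CorePair23.Matched Y) ∧ ¬ r1CorePair23.Matched zeroCell ∧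
    ¬ r1CorePair23.Heavy (OnPair 2 3) := by
  refine ⟨?_, by decide, by decide⟩
  decide

theorem r1FullPair23_sizes : r1FullPair23.lower.length = 105 ∧ r1FullPair23.upper.length = 71 := by decide

/-- CENSUS INSTANCE (j305149 r1 `full` minus-A2I⁻ — the `Ψ`-balanced variant; pair `{2,3}`): all cells psd on `{2,3}`; matching holds except at
the zero cell (104∕105); unit-multiplicity (B1) fails 105 > 71 (Hall deficiency 34). -/
theorem r1FullPair23_census :
    (∀ X ∈ r1FullPair23.lower ++ r1FullPair23.upper, X.Psd ∧ OnPair 2 3 X) ∧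
    (∀ Y ∈ r1FullPair23.lower, Y ≠ zeroCell → r1FullPair23.Matched Y) ∧ ¬ r1FullPair23.Matched zeroCell ∧
    ¬ r1FullPair23.Heavy (OnPair 2 3) := by
  refine ⟨by decide, ?_, by decide, by decide⟩
  decide

/-- DESIGNS OF RECORD are two-factor-free (every cell is non-zero on ≥ 3 factors): the law is vacuous on the ◇₈ ceiling fragment `c8Fragment`
(49 cells; likewise — by the digit table, not typed here — on all of `c8`, RB16 `supp-c4c48e1e`, `supp-a1a8405d`, `supp-bd78f9c7`: zero two-factor
cells on either level), consistent with their being leak-free (no lower cell of Hermitian rank ≤ 2, LINE 15). -/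
theorem designsOfRecord_twoFactorFree : c8Fragment.TwoFactorFree ∧ ¬ c8Fragment.DiagLeak := by decide

theorem designsOfRecord_law : c8Fragment.MatchingLaw ∧ c8Fragment.PrincipalHeavy :=
  ⟨Support.matchingLaw_of_twoFactorFree _ designsOfRecord_twoFactorFree.1,
   Support.principalHeavy_of_twoFactorFree _ designsOfRecord_twoFactorFree.1⟩

/-- the toy floor support of LINE 15 (`{N[O|O|O|4ℓ₁], N[ℓ₁]⁴ ; P[O|O|O|3ℓ₁]}`) obeys matching and principal heaviness (1 ≤ 1) — a live,
matched floor-hung fragment: the forced shape of `Support.forcedShape` realised. -/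
theorem toyFloor_law : toyFloor.MatchingLaw ∧ toyFloor.PrincipalHeavy ∧ toyFloor.DiagLeak := by decide

/-! ## §5 The ray lemma: Hermitian rank is monotone in the psd order (rev 1.1)

A psd letter below a NULL letter `y` (`α² = |β|²`: a ray letter `cℓ_ζ`, the fibre class of `π_ζ : S → E`) is itself null or zero AND lies on the same ray
(equality case of Cauchy–Schwarz in `ℤ²`).  Hence `hrank` is monotone (`W ≤ Y ⇒ hrank W ≤ hrank Y`), and the matching cell of `forcedShape` is itself a low cell:
the leak room's UPPER level contains a cell of Hermitian rank ≤ 2 on the rays ∕ factors of the leak cell (`forcedShape'`). -/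

namespace Letter

theorem hrank_le_two (x : Letter) : x.hrank ≤ 2 := by
  unfold hrank; split_ifs <;> omega

/-- psd `x ≤ y` with `y` null ⇒ `x` null or zero (`α_x² = |β_x|²`). -/
theorem sq_eq_of_lle_null (x y : Letter) (hx : x.Psd) (hxy : lle x y) (hy : y.a * y.a = y.s) : x.a * x.a = x.s := by
  obtain ⟨a, b, c⟩ := x; obtain ⟨d, e, f⟩ := y
  simp only [lle, Psd, sub, Letter.a, Letter.s] at hx hxy hy ⊢
  obtain ⟨ha, hS⟩ := hx; obtain ⟨hda, h2⟩ := hxy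
  -- T := b e + c f;  u := a² − S ≥ 0;  2T ≥ 2ad − u;  T² ≤ S d² (Lagrange);  (ad − u/2)² ≤ T² ≤ (a² − u) d²  ⇒  u² ≤ 4ud(a − d) ≤ 0.
  have hd : 0 ≤ d := le_trans ha (by linarith)
  have hT : 2 * (b * e + c * f) ≥ 2 * a * d - (a * a - (b * b + c * c)) := by nlinarith
  have hL : (b * e + c * f) * (b * e + c * f) ≤ (b * b + c * c) * (d * d) := by nlinarith [mul_self_nonneg (b * f - c * e)]
  have hm : 0 ≤ 2 * a * d - (a * a - (b * b + c * c)) := by nlinarith [mul_nonneg ha hd, mul_self_nonneg b, mul_self_nonneg c]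
  have hsq : (2 * a * d - (a * a - (b * b + c * c))) * (2 * a * d - (a * a - (b * b + c * c))) ≤ 4 * ((b * e + c * f) * (b * e + c * f)) := by
    nlinarith [mul_nonneg hm hm]
  nlinarith [mul_nonneg (sub_nonneg.mpr hS) (mul_nonneg hd (sub_nonneg.mpr (show a ≤ d by linarith))), mul_self_nonneg (a * a - (b * b + c * c))]

/-- … and `x` lies on the ray of `y`: `α_y β_x = α_x β_y`. -/
theorem ray_of_lle_null (x y : Letter) (hx : x.Psd) (hxy : lle x y) (hy : y.a * y.a = y.s) :
    y.a * x.2.1 = x.a * y.2.1 ∧ y.a * x.2.2 = x.a * y.2.2 := by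
  have hxs := sq_eq_of_lle_null x y hx hxy hy
  obtain ⟨a, b, c⟩ := x; obtain ⟨d, e, f⟩ := y
  simp only [lle, Psd, sub, Letter.a, Letter.s] at hx hxy hy hxs ⊢
  obtain ⟨ha, hS⟩ := hx; obtain ⟨hda, h2⟩ := hxy
  have hd : 0 ≤ d := le_trans ha (by linarith)
  have hT1 : a * d ≤ b * e + c * f := by nlinarith
  have hL : (b * e + c * f) * (b * e + c * f) ≤ (b * b + c * c) * (d * d) := by nlinarith [mul_self_nonneg (b * f - c * e)]
  have hT2 : b * e + c * f ≤ a * d := by nlinarith [mul_nonneg ha hd]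
  have hT : b * e + c * f = a * d := le_antisymm hT2 hT1
  have key : (d * b - a * e) * (d * b - a * e) + (d * c - a * f) * (d * c - a * f) = 0 := by nlinarith
  constructor
  · nlinarith [mul_self_nonneg (d * b - a * e), mul_self_nonneg (d * c - a * f)]
  · nlinarith [mul_self_nonneg (d * b - a * e), mul_self_nonneg (d * c - a * f)]

/-- Hermitian rank is monotone in the psd order. -/
theorem hrank_le_of_lle (x y : Letter) (hx : x.Psd) (hxy : lle x y) : x.hrank ≤ y.hrank := by
  by_cases hy0 : y.1 = 0 ∧ y.2.1 = 0 ∧ y.2.2 = 0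
  · have hyO : y = O := by obtain ⟨d, e, f⟩ := y; obtain ⟨rfl, rfl, rfl⟩ := hy0; rfl
    subst hyO
    have := eq_O_of_psd_of_lle_O x hx hxy
    subst this
    exact le_refl _
  by_cases hyn : y.a * y.a = y.s
  · have hxn := sq_eq_of_lle_null x y hx hxy hyn
    have h1 : x.hrank ≤ 1 := by unfold hrank; split_ifs <;> omega
    have h2 : 1 ≤ y.hrank := by
      unfold hrank; rw [if_neg hy0, if_pos hyn]
    omega
  · have h2 : y.hrank = 2 := by unfold hrank; rw [if_neg hy0, if_neg hyn]
    rw [h2]; exact hrank_le_two x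

end Letter

/-- Hermitian rank of cells is monotone in the psd order. -/
theorem Cell.hrank_le_of_cle {W Y : Cell} (hW : W.Psd) (h : cle W Y) : W.hrank ≤ Y.hrank := by
  have h0 := Letter.hrank_le_of_lle _ _ (psd_apply hW 0) (lle_of_cle h 0)
  have h1 := Letter.hrank_le_of_lle _ _ (psd_apply hW 1) (lle_of_cle h 1)
  have h2 := Letter.hrank_le_of_lle _ _ (psd_apply hW 2) (lle_of_cle h 2)
  have h3 := Letter.hrank_le_of_lle _ _ (psd_apply hW 3) (lle_of_cle h 3)
  unfold Cell.hrank; omega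

/-- FORCED SHAPE, sharpened: the matching upper cell under a diag-leak cell is itself of Hermitian rank ≤ that of the leak cell (≤ 2) and lies on its rays
(`Letter.ray_of_lle_null`): the leak room's `𝓟`-level carries a constituent pulled back from the SAME curve∕surface quotient, strictly smaller. -/
theorem Support.forcedShape' (S : Support) (hU : ∀ W ∈ S.upper, W.Psd) (hleak : S.DiagLeak) (hlaw : S.MatchingLaw) :
    ∃ Y ∈ S.lower, ∃ W ∈ S.upper, Y.hrank ≤ 2 ∧ clt W Y ∧ W.hrank ≤ Y.hrank := by
  obtain ⟨Y, hY, hr⟩ := hleak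
  obtain ⟨W, hW, hlt⟩ := hlaw Y hY (twoFactor_of_hrank_le_two Y hr)
  exact ⟨Y, hY, W, hW, hr, hlt, Cell.hrank_le_of_cle (hU W hW) hlt.1⟩

/-! ## §6 Bidegree separation — the independence step of THEOREM NC over ANY `ℕ × ℕ`-graded commutative `ℂ`-algebra (rev 1.2)

The cohomology ring `H^*(P; ℂ)` is bigraded by the `ψ^*`-eigenspace decomposition `H¹ = V₊ ⊕ V₋` (`(a,b) = Λ^a V₊ ⊗ Λ^b V₋`); `h ∈ (1,1)`, so `h⁴ ∈ (4,4)`;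
the Weil parts `w₊ ∈ (8,0)`, `w₋ ∈ (0,8)`; a class pulled back from `H^k(B)`, `k ≤ 3`, is supported in total degree `≤ 3`.  The lemma below is the
step «distinct bidegree components are independent, so `q·(h⁴ ∪ π^*γ) = 0`» of NC₁∕NC₂, for an arbitrary graded algebra (Mathlib `GradedAlgebra` over `ℕ × ℕ`);
the remaining inputs of NC (existence of the bigrading, the bidegrees of `h` and `w`, hard Lefschetz ∕ Künneth injectivity `h⁴ ∪ π^*γ ≠ 0`) stay pencil. -/

section BidegreeSeparation

open DirectSum Classical

variable {A : Type*} [CommRing A] [Algebra ℂ A] (𝒜 : ℕ × ℕ → Submodule ℂ A) [GradedAlgebra 𝒜]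

/-- BIDEGREE SEPARATION: `h4 ∈ 𝒜(4,4)`, `wp ∈ 𝒜(8,0)`, `wm ∈ 𝒜(0,8)`, `γ` supported in total degree `≤ 3`;
`q • h4·γ + (wp + wm)·γ = 0 ⇒ q • h4·γ = 0` (project onto bidegree `(4,4) + (a,b)`, where `wp·γ`, `wm·γ` have no component: `noCollision₃`). -/
theorem bidegree_separation (q : ℂ) (h4 wp wm γ : A) (hh : h4 ∈ 𝒜 (4, 4)) (hwp : wp ∈ 𝒜 (8, 0)) (hwm : wm ∈ 𝒜 (0, 8))
    (hγ : ∀ ij ∈ (decompose 𝒜 γ).support, ij.1 + ij.2 ≤ 3)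
    (H : q • (h4 * γ) + (wp + wm) * γ = 0) : q • (h4 * γ) = 0 := by
  have comp : ∀ ij ∈ (decompose 𝒜 γ).support, q • (h4 * (decompose 𝒜 γ ij : A)) = 0 := by
    intro ij hij
    have hab := hγ ij hij
    have Hn := congrArg (GradedAlgebra.proj 𝒜 ((4, 4) + ij)) H
    rw [add_mul, map_add, map_add, map_smul, map_zero, GradedAlgebra.proj_apply, GradedAlgebra.proj_apply,
      GradedAlgebra.proj_apply] at Hn
    have e1 : (decompose 𝒜 (h4 * γ) ((4, 4) + ij) : A) = h4 * decompose 𝒜 γ ij :=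
      DirectSum.coe_decompose_mul_add_of_left_mem 𝒜 (i := (4, 4)) (j := ij) hh
    have n1 : ¬ ((8, 0) : ℕ × ℕ) ≤ (4, 4) + ij := by
      obtain ⟨a, b⟩ := ij; simp only [Prod.mk_add_mk, Prod.mk_le_mk, not_and, not_le]; intro h; simp at hab; omega
    have n2 : ¬ ((0, 8) : ℕ × ℕ) ≤ (4, 4) + ij := by
      obtain ⟨a, b⟩ := ij; simp only [Prod.mk_add_mk, Prod.mk_le_mk, not_and, not_le]; intro h; simp at hab; omega
    have e2 : (decompose 𝒜 (wp * γ) ((4, 4) + ij) : A) = 0 := DirectSum.coe_decompose_mul_of_left_mem_of_not_le 𝒜 hwp n1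
    have e3 : (decompose 𝒜 (wm * γ) ((4, 4) + ij) : A) = 0 := DirectSum.coe_decompose_mul_of_left_mem_of_not_le 𝒜 hwm n2
    rw [e1, e2, e3, add_zero, add_zero] at Hn
    exact Hn
  have hγsum : γ = ∑ ij ∈ (decompose 𝒜 γ).support, (decompose 𝒜 γ ij : A) := (sum_support_decompose 𝒜 γ).symm
  calc q • (h4 * γ) = q • (h4 * ∑ ij ∈ (decompose 𝒜 γ).support, (decompose 𝒜 γ ij : A)) := by rw [← hγsum]
    _ = ∑ ij ∈ (decompose 𝒜 γ).support, q • (h4 * (decompose 𝒜 γ ij : A)) := by rw [Finset.mul_sum, Finset.smul_sum]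
    _ = 0 := Finset.sum_eq_zero comp

/-- … hence `q = 0` as soon as `h⁴·γ ≠ 0` (NC₁: hard Lefschetz on `H^{≤3}` + `π^*` injective; NC₂: the Künneth component `γ ⊗ (h|_K)⁴`). -/
theorem q_eq_zero_of_bidegree_separation [NoZeroSMulDivisors ℂ A] (q : ℂ) (h4 wp wm γ : A) (hh : h4 ∈ 𝒜 (4, 4))
    (hwp : wp ∈ 𝒜 (8, 0)) (hwm : wm ∈ 𝒜 (0, 8)) (hγ : ∀ ij ∈ (decompose 𝒜 γ).support, ij.1 + ij.2 ≤ 3)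
    (H : q • (h4 * γ) + (wp + wm) * γ = 0) (hinj : h4 * γ ≠ 0) : q = 0 :=
  (smul_eq_zero.mp (bidegree_separation 𝒜 q h4 wp wm γ hh hwp hwm hγ H)).resolve_right hinj

/-- The Weil part pairs to zero against a factor-pair class on its own (NC₂: `π_{fg}^*H⁷(S_f × S_g)` has bidegrees `(4,3) + (3,4)`, and `(8,0) + (4,3) = (12,3)`
exceeds `dim V₊ = 8`): abstractly, if `𝒜(i,j) = 0` whenever `i > 8` or `j > 8`, then `wp·γ = 0 = wm·γ` for `γ` supported in bidegrees with both coordinates `≥ 1`… we record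
only the shape used: components of `wp * γ` live in degrees `≥ (8,0) + (a,b)` with `a ≥ 3` — beyond the top `a`-degree 8 when `a + 8 > 8`. -/
theorem weil_pairs_zero (wp γ : A) (hwp : wp ∈ 𝒜 (8, 0)) (htop : ∀ ij : ℕ × ℕ, 8 < ij.1 → 𝒜 ij = ⊥)
    (hγ : ∀ ij ∈ (decompose 𝒜 γ).support, 1 ≤ ij.1) : wp * γ = 0 := by
  have hγsum : γ = ∑ ij ∈ (decompose 𝒜 γ).support, (decompose 𝒜 γ ij : A) := (sum_support_decompose 𝒜 γ).symm
  rw [hγsum, Finset.mul_sum]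
  refine Finset.sum_eq_zero fun ij hij => ?_
  have hmem : wp * (decompose 𝒜 γ ij : A) ∈ 𝒜 ((8, 0) + ij) := SetLike.mul_mem_graded hwp (Subtype.mem _)
  have hbot := htop ((8, 0) + ij) (by obtain ⟨a, b⟩ := ij; have := hγ _ hij; simp at this ⊢; omega)
  rw [hbot, Submodule.mem_bot] at hmem
  exact hmem

end BidegreeSeparation

/-! ## §7 The multiplicity-level row (B1) typed (rev 1.3, critic price p3 of l.9868)

A DESIGN carries multiplicities `mN, mP : Cell → ℕ` on its lower ∕ upper cells; the DOWNSET LAW's rank count is LINEAR in them: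
`Σ_{Y ∈ 𝓝 ∩ I} mN Y ≤ Σ_{W ∈ 𝓟 ∩ I} mP W` for every two-factor order ideal `I` (`HeavyM`).  An upper zero cell `𝒪 = P[O⁴]` needs no special term:
`zeroCell` lies in every non-empty order ideal (`zeroCell_clt`), so `mP zeroCell` is counted in every row automatically.  `Heavy` of §2 is the unit case
`mN = mP = 1` (`heavy_iff_heavyM_one`), which is why the §4 digits (66 > 48, 105 > 71: `¬Heavy`) are READINGS of supports, not violations by a design. -/

namespace Support

/-- (B1) at multiplicity level on the ideal cut out by `I`: `Σ_{lower ∩ I} mN ≤ Σ_{upper ∩ I} mP` (sums over the listed support cells). -/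
def HeavyM (S : Support) (mN mP : Cell → ℕ) (I : Cell → Prop) [DecidablePred I] : Prop :=
  ((S.lower.filter fun X => decide (I X)).map mN).sum ≤ ((S.upper.filter fun X => decide (I X)).map mP).sum

instance (S : Support) (mN mP : Cell → ℕ) (I : Cell → Prop) [DecidablePred I] : Decidable (S.HeavyM mN mP I) := by
  unfold HeavyM; infer_instance

/-- (B1) at multiplicity level on every factor-pair ideal. -/
def PairHeavyM (S : Support) (mN mP : Cell → ℕ) : Prop := ∀ f g : Fin 4, f < g → S.HeavyM mN mP (OnPair f g)

/-- (B1) at multiplicity level on every principal downset of a two-factor lower cell. -/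
def PrincipalHeavyM (S : Support) (mN mP : Cell → ℕ) : Prop := ∀ Y ∈ S.lower, TwoFactor Y → S.HeavyM mN mP (fun X => cle X Y)

theorem sum_map_one_eq_countP (l : List Cell) (p : Cell → Bool) : ((l.filter p).map (fun _ => (1 : ℕ))).sum = l.countP p := by
  rw [List.map_const', List.sum_replicate, smul_eq_mul, mul_one, List.countP_eq_length_filter]

/-- `Heavy` (§2, unit multiplicity) is `HeavyM 1 1`. -/
theorem heavy_iff_heavyM_one (S : Support) (I : Cell → Prop) [DecidablePred I] :
    S.Heavy I ↔ S.HeavyM (fun _ => 1) (fun _ => 1) I := by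
  unfold Heavy HeavyM
  rw [sum_map_one_eq_countP, sum_map_one_eq_countP]

theorem pairHeavy_iff_pairHeavyM_one (S : Support) : S.PairHeavy ↔ S.PairHeavyM (fun _ => 1) (fun _ => 1) := by
  unfold PairHeavy PairHeavyM
  exact forall₃_congr fun f g _ => heavy_iff_heavyM_one S _

/-- Monotonicity of the row in the multiplicities: raising upper multiplicities ∕ lowering lower ones keeps (B1). -/
theorem HeavyM.mono {S : Support} {mN mN' mP mP' : Cell → ℕ} (hN : ∀ X, mN' X ≤ mN X) (hP : ∀ X, mP X ≤ mP' X)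
    (I : Cell → Prop) [DecidablePred I] (h : S.HeavyM mN mP I) : S.HeavyM mN' mP' I := by
  unfold HeavyM at *
  calc ((S.lower.filter fun X => decide (I X)).map mN').sum ≤ ((S.lower.filter fun X => decide (I X)).map mN).sum :=
        List.sum_le_sum (fun X _ => hN X)
    _ ≤ ((S.upper.filter fun X => decide (I X)).map mP).sum := h
    _ ≤ ((S.upper.filter fun X => decide (I X)).map mP').sum := List.sum_le_sum (fun X _ => hP X)

/-- The unit READING bounds designs from one side only: if a support is unit-light on `I` by a deficiency `d` (`#N∩I = #P∩I + d`), a design on it with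
lower multiplicities ≥ 1 needs upper mass `Σ_{𝓟∩I} mP ≥ #P∩I + d` on `I` — e.g. ≥ 66 on each factor-pair ideal of the r1 `core_only` witness (48 upper cells). -/
theorem upper_mass_of_heavyM {S : Support} {mN mP : Cell → ℕ} (I : Cell → Prop) [DecidablePred I] (hN : ∀ X, 1 ≤ mN X)
    (h : S.HeavyM mN mP I) : S.lower.countP (fun X => decide (I X)) ≤ ((S.upper.filter fun X => decide (I X)).map mP).sum := by
  have h1 : S.HeavyM (fun _ => 1) mP I := HeavyM.mono (mN := mN) (mP := mP) (fun X => hN X) (fun X => le_refl _) I h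
  unfold HeavyM at h1
  rwa [sum_map_one_eq_countP] at h1

/-- r1 `core_only` pair {2,3}: any design on this support with all lower multiplicities ≥ 1 must put total upper multiplicity ≥ 66 on the 48 upper cells of
the pair-{2,3} ideal (so some upper ray∕pair cell is repeated) — the multiplicity-level reading of `r1CorePair23_census`. -/
theorem r1CorePair23_upper_mass {mN mP : Cell → ℕ} (hN : ∀ X, 1 ≤ mN X) (h : r1CorePair23.HeavyM mN mP (OnPair 2 3)) :
    66 ≤ ((r1CorePair23.upper.filter fun X => decide (OnPair 2 3 X)).map mP).sum := by
  have := upper_mass_of_heavyM (OnPair 2 3) hN h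
  have hc : r1CorePair23.lower.countP (fun X => decide (OnPair 2 3 X)) = 66 := by decide
  omega

/-! ### §7′ (rev 1.4, riders t1–t3 of idea-crit-hsem-2 g5, bus l.≈9952) — support-relative hypotheses and the zero-cell term
CONVENTION (t2): in §7 the lists `S.lower ∕ S.upper` are read as SUPPORTS (duplicate-free) and the design multiplicities live in `mN ∕ mP`; §2's
`Heavy` on a list WITH repetitions is the other convention, and `heavy_iff_heavyM_one` is the bridge — use one convention at a time.  (t1) the primed
versions below assume `1 ≤ mN` only ON the lower support.  (t3) the zero cell contributes `mP zeroCell` to every row whose ideal contains it — which is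
every factor-pair ideal and every principal downset — PROVIDED `zeroCell` is LISTED in `S.upper` (PREREG clause (i) decides whether the universe admits it). -/

theorem HeavyM.mono' {S : Support} {mN mN' mP mP' : Cell → ℕ} (hN : ∀ X ∈ S.lower, mN' X ≤ mN X) (hP : ∀ X ∈ S.upper, mP X ≤ mP' X)
    (I : Cell → Prop) [DecidablePred I] (h : S.HeavyM mN mP I) : S.HeavyM mN' mP' I := by
  unfold HeavyM at *
  calc ((S.lower.filter fun X => decide (I X)).map mN').sum ≤ ((S.lower.filter fun X => decide (I X)).map mN).sum :=
        List.sum_le_sum (fun X hX => hN X (List.mem_of_mem_filter hX))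
    _ ≤ ((S.upper.filter fun X => decide (I X)).map mP).sum := h
    _ ≤ ((S.upper.filter fun X => decide (I X)).map mP').sum := List.sum_le_sum (fun X hX => hP X (List.mem_of_mem_filter hX))

/-- `upper_mass_of_heavyM` with the multiplicity floor assumed only on the lower SUPPORT (t1). -/
theorem upper_mass_of_heavyM' {S : Support} {mN mP : Cell → ℕ} (I : Cell → Prop) [DecidablePred I] (hN : ∀ X ∈ S.lower, 1 ≤ mN X)
    (h : S.HeavyM mN mP I) : S.lower.countP (fun X => decide (I X)) ≤ ((S.upper.filter fun X => decide (I X)).map mP).sum := by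
  have h1 : S.HeavyM (fun _ => 1) mP I := HeavyM.mono' (mN := mN) (mP := mP) hN (fun X _ => le_refl _) I h
  unfold HeavyM at h1
  rwa [sum_map_one_eq_countP] at h1

theorem r1CorePair23_upper_mass' {mN mP : Cell → ℕ} (hN : ∀ X ∈ r1CorePair23.lower, 1 ≤ mN X)
    (h : r1CorePair23.HeavyM mN mP (OnPair 2 3)) :
    66 ≤ ((r1CorePair23.upper.filter fun X => decide (OnPair 2 3 X)).map mP).sum := by
  have := upper_mass_of_heavyM' (OnPair 2 3) hN h
  have hc : r1CorePair23.lower.countP (fun X => decide (OnPair 2 3 X)) = 66 := by decide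
  omega

/-- (t3) A listed upper zero cell contributes its multiplicity to every row whose ideal contains `zeroCell`. -/
theorem zeroCell_mass_le (S : Support) (mP : Cell → ℕ) (I : Cell → Prop) [DecidablePred I] (hI : I zeroCell) (hz : zeroCell ∈ S.upper) :
    mP zeroCell ≤ ((S.upper.filter fun X => decide (I X)).map mP).sum := by
  apply List.le_sum_of_mem
  exact List.mem_map.mpr ⟨zeroCell, List.mem_filter.mpr ⟨hz, by simpa using hI⟩, rfl⟩

end Support

/-- `zeroCell` lies in every factor-pair ideal … -/
theorem onPair_zeroCell (f g : Fin 4) : OnPair f g zeroCell := fun _ _ _ => rfl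

/-- … and below every psd cell, hence in every principal downset. -/
theorem zeroCell_cle (Y : Cell) (hY : Y.Psd) : cle zeroCell Y := by
  unfold cle Cell.Psd Cell.sub
  have key : ∀ f, lle (zeroCell f) (Y f) := by
    intro f
    have hf := psd_apply hY f
    generalize hy : Y f = y at hf ⊢
    obtain ⟨a, b, c⟩ := y
    simp only [lle, Letter.Psd, Letter.sub, Letter.a, Letter.s, zeroCell, O, sub_zero] at hf ⊢
    exact hf
  exact ⟨key 0, key 1, key 2, key 3⟩

namespace Support

/-- (t3) made concrete: with `zeroCell ∈ S.upper`, every factor-pair row (B1) receives the term `mP zeroCell`. -/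
theorem zeroCell_mass_le_pair (S : Support) (mP : Cell → ℕ) (f g : Fin 4) (hz : zeroCell ∈ S.upper) :
    mP zeroCell ≤ ((S.upper.filter fun X => decide (OnPair f g X)).map mP).sum :=
  zeroCell_mass_le S mP (OnPair f g) (onPair_zeroCell f g) hz

/-- … and so does every principal-downset row `↓Y` of a psd lower cell. -/
theorem zeroCell_mass_le_principal (S : Support) (mP : Cell → ℕ) (Y : Cell) (hY : Y.Psd) (hz : zeroCell ∈ S.upper) :
    mP zeroCell ≤ ((S.upper.filter fun X => decide (cle X Y)).map mP).sum :=
  zeroCell_mass_le S mP (fun X => cle X Y) (zeroCell_cle Y hY) hz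

end Support

/-! ## §8 GENERAL POSITION LAW — NC₃ (rev 1.5): covered cells, FACTOR-RAY and FACTOR-RAY-RAY ideals

THEOREM NC₃ (pencil, card rev 1.5 § The law): for every quotient `π : P ↠ B` of the anchor through which SOME factor projection `P → S_f` factors,
`dim π(Z) = min(4, dim B)` — the carrier is in general position with respect to every such quotient (NC₂ = the case `B = S_f × S_g`).  Pencil inputs:
the `sl₂`∕hard-Lefschetz lemma «`h⁴ ∪ x ≠ 0 ⇔ Λ^{k−4} x ≠ 0` on `H^k`, `5 ≤ k ≤ 8`», `U_f := π_f^* H¹(S_f)` is an `h⁻¹`-symplectic 4-plane, and for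
`π^*γ = ω_f ∧ x` (resp. `ω_f ∧ y`) every bidegree component has both partial degrees `≥ 2`, so the Weil parts of `[Z] ∪ π^*γ` vanish and §6 separation
gives `h⁴ ∪ π^*γ = 0`, contradicting `Λ(ω_f ∧ x) = (Λω_f) ∧ x ≠ 0`.  CENSUS SHADOW through the block-diagonal dictionary (radical of a cell = product of
the per-factor radicals, `dim B(Y) = hrank Y`): a cell `Y` is COVERED iff for some `f` the other three letters have total rank ≤ 2 (`↓Y` is then pulled back from
`S_f × Π_{g≠f} S_g ∕ rad Y_g`, dim ≤ 4, a whole factor surviving) — the NEW covered types are the THREE-FACTOR cells `(null, null, null, O)` and `(definite, null, null, O)`; the new rowed order ideals are `FR f g ζ` (from `S_f × E_ζ(S_g)`, dim 3) and `FRR f g g′ ζ ζ′`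
(from `S_f × E_ζ(S_g) × E_ζ′(S_g′)`, dim 4).  (B1)⁺ = `HeavyM` on them; (B2)⁺ = `MatchingLawGP`; digits on the r1 `core_only` witness below
(unit multiplicities = READINGS of SAT supports, not violations by a design).  HC ∕ HC_CM ∕ HC_AV ∕ H2 ∕ 18881 NOT proved. -/

theorem Letter.hrank_O : Letter.hrank O = 0 := by decide

theorem Cell.hrank_eq_sum (Y : Cell) : Y.hrank = ∑ f, (Y f).hrank := by
  simp [Cell.hrank, Fin.sum_univ_four]

/-- COVERED cell (rev 1.5): for some factor `f`, the other three letters have total Hermitian rank ≤ 2 — then the principal downset `↓Y` is pulled back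
from the quotient `S_f × Π_{g ≠ f} (S_g ∕ rad Y_g)` of dimension `2 + Σ_{g ≠ f} hrank Y_g ≤ 4`, through which the factor projection `P → S_f` factors, and
NC₃ applies.  Covered types: every cell of hrank ≤ 2, (2,1,0,0), (2,2,0,0), (1,1,1,0), (2,1,1,0); NOT covered: (1,1,1,1), (2,1,1,1), (2,2,1,0), … -/
def Covered (Y : Cell) : Prop := ∃ f : Fin 4, Y.hrank ≤ 2 + (Y f).hrank

instance (Y : Cell) : Decidable (Covered Y) := by unfold Covered; infer_instance

/-- Two-factor cells are covered (so (B2)⁺ below strengthens §2's MATCHING LAW). -/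
theorem covered_of_twoFactor (Y : Cell) (h : TwoFactor Y) : Covered Y := by
  unfold Covered
  unfold TwoFactor at h
  have hsum : Y.hrank = ∑ f ∈ nz Y, (Y f).hrank := by
    rw [Cell.hrank_eq_sum]
    symm
    apply Finset.sum_subset (Finset.subset_univ _)
    intro f _ hf
    simp only [nz, Finset.mem_filter, Finset.mem_univ, true_and, not_not] at hf
    rw [hf]; exact Letter.hrank_O
  by_cases hne : (nz Y).Nonempty
  · obtain ⟨f, hf⟩ := hne
    refine ⟨f, ?_⟩
    have hsplit := Finset.add_sum_erase (nz Y) (fun g => (Y g).hrank) hf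
    have hle := Finset.sum_le_card_nsmul ((nz Y).erase f) (fun g => (Y g).hrank) 2 (fun g _ => Letter.hrank_le_two _)
    have hcard := Finset.card_erase_of_mem hf
    simp only [smul_eq_mul] at hle
    rw [hsum]; omega
  · rw [Finset.not_nonempty_iff_eq_empty] at hne
    refine ⟨0, ?_⟩
    rw [hsum, hne, Finset.sum_empty]; omega

/-- Cells of Hermitian rank ≤ 2 (NC₁'s diag-leak cells) are covered. -/
theorem covered_of_hrank_le_two (Y : Cell) (h : Y.hrank ≤ 2) : Covered Y := ⟨0, by omega⟩

/-- (B2)⁺ — MATCHING LAW on all covered lower cells. -/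
def Support.MatchingLawGP (S : Support) : Prop := ∀ Y ∈ S.lower, Covered Y → S.Matched Y

theorem Support.matchingLaw_of_matchingLawGP (S : Support) (h : S.MatchingLawGP) : S.MatchingLaw :=
  fun Y hY h2 => h Y hY (covered_of_twoFactor Y h2)

/-- `x` lies on the closed ray of the null direction `ζ`: `x = O`, or `x` is null with `α_ζ β_x = α_x β_ζ`. -/
def InRay (ζ x : Letter) : Prop := x = O ∨ (x.a * x.a = x.s ∧ ζ.a * x.2.1 = x.a * ζ.2.1 ∧ ζ.a * x.2.2 = x.a * ζ.2.2)

instance (ζ x : Letter) : Decidable (InRay ζ x) := by unfold InRay; infer_instance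

/-- FACTOR-RAY ideal `FR(f; g, ζ)`: arbitrary on `f`, on the ray `ζ` (or `O`) on `g`, `O` elsewhere — cells pulled back from `S_f × E_ζ(S_g)` (dim 3). -/
def FR (f g : Fin 4) (ζ : Letter) (X : Cell) : Prop := (∀ k : Fin 4, k ≠ f → k ≠ g → X k = O) ∧ InRay ζ (X g)

instance (f g : Fin 4) (ζ : Letter) (X : Cell) : Decidable (FR f g ζ X) := by unfold FR; infer_instance

/-- FACTOR-RAY-RAY ideal `FRR(f; g, ζ; g′, ζ′)`: cells pulled back from `S_f × E_ζ(S_g) × E_ζ′(S_g′)` (dim 4) — contains genuinely THREE-FACTOR cells. -/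
def FRR (f g g' : Fin 4) (ζ ζ' : Letter) (X : Cell) : Prop :=
  (∀ k : Fin 4, k ≠ f → k ≠ g → k ≠ g' → X k = O) ∧ InRay ζ (X g) ∧ InRay ζ' (X g')

instance (f g g' : Fin 4) (ζ ζ' : Letter) (X : Cell) : Decidable (FRR f g g' ζ ζ' X) := by unfold FRR; infer_instance

/-- The closed ray is down-closed in the psd order (§5 ray lemma). -/
theorem inRay_of_lle {ζ w x : Letter} (hw : w.Psd) (hx : x.Psd) (h : lle w x) (hxr : InRay ζ x) : InRay ζ w := by
  rcases hxr with rfl | ⟨hnull, hb, hc⟩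
  · left; exact eq_O_of_psd_of_lle_O w hw h
  · by_cases hxa : x.a = 0
    · have hxO : x = O := by
        obtain ⟨a, b, c⟩ := x
        simp only [Letter.Psd, Letter.a, Letter.s] at hx hxa
        obtain ⟨_, hs⟩ := hx
        rw [hxa] at hs
        have hb0 : b = 0 := mul_self_eq_zero.mp (by nlinarith [mul_self_nonneg b, mul_self_nonneg c])
        have hc0 : c = 0 := mul_self_eq_zero.mp (by nlinarith [mul_self_nonneg b, mul_self_nonneg c])
        subst hb0; subst hc0
        show ((a, (0:ℤ), (0:ℤ)) : Letter) = O
        rw [show a = 0 from hxa]; rfl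
      subst hxO
      left; exact eq_O_of_psd_of_lle_O w hw h
    · right
      have hws := Letter.sq_eq_of_lle_null w x hw h hnull
      obtain ⟨hrb, hrc⟩ := Letter.ray_of_lle_null w x hw h hnull
      refine ⟨hws, ?_, ?_⟩
      · have key : x.a * (ζ.a * w.2.1) = x.a * (w.a * ζ.2.1) := by
          calc x.a * (ζ.a * w.2.1) = ζ.a * (x.a * w.2.1) := by ring
            _ = ζ.a * (w.a * x.2.1) := by rw [hrb]
            _ = w.a * (ζ.a * x.2.1) := by ring
            _ = w.a * (x.a * ζ.2.1) := by rw [hb]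
            _ = x.a * (w.a * ζ.2.1) := by ring
        exact mul_left_cancel₀ hxa key
      · have key : x.a * (ζ.a * w.2.2) = x.a * (w.a * ζ.2.2) := by
          calc x.a * (ζ.a * w.2.2) = ζ.a * (x.a * w.2.2) := by ring
            _ = ζ.a * (w.a * x.2.2) := by rw [hrc]
            _ = w.a * (ζ.a * x.2.2) := by ring
            _ = w.a * (x.a * ζ.2.2) := by rw [hc]
            _ = x.a * (w.a * ζ.2.2) := by ring
        exact mul_left_cancel₀ hxa key

/-- `FR(f; g, ζ)` is an order ideal of the psd cells. -/
theorem FR_of_cle {f g : Fin 4} {ζ : Letter} {W Y : Cell} (hW : W.Psd) (hY : Y.Psd) (h : cle W Y) (hI : FR f g ζ Y) : FR f g ζ W := by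
  obtain ⟨hO, hray⟩ := hI
  refine ⟨fun k hkf hkg => ?_, inRay_of_lle (psd_apply hW g) (psd_apply hY g) (lle_of_cle h g) hray⟩
  have hk := lle_of_cle h k
  rw [hO k hkf hkg] at hk
  exact eq_O_of_psd_of_lle_O _ (psd_apply hW k) hk

/-- `FRR(f; g, ζ; g′, ζ′)` is an order ideal of the psd cells. -/
theorem FRR_of_cle {f g g' : Fin 4} {ζ ζ' : Letter} {W Y : Cell} (hW : W.Psd) (hY : Y.Psd) (h : cle W Y) (hI : FRR f g g' ζ ζ' Y) :
    FRR f g g' ζ ζ' W := by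
  obtain ⟨hO, hray, hray'⟩ := hI
  refine ⟨fun k hkf hkg hkg' => ?_, inRay_of_lle (psd_apply hW g) (psd_apply hY g) (lle_of_cle h g) hray,
    inRay_of_lle (psd_apply hW g') (psd_apply hY g') (lle_of_cle h g') hray'⟩
  have hk := lle_of_cle h k
  rw [hO k hkf hkg hkg'] at hk
  exact eq_O_of_psd_of_lle_O _ (psd_apply hW k) hk

/-- A factor-ray ideal lies inside its factor-pair ideal (its (B1) row is FINER than the pair row). -/
theorem onPair_of_FR {f g : Fin 4} {ζ : Letter} {X : Cell} (h : FR f g ζ X) : OnPair f g X := h.1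

/-- the FACTOR-RAY ideal `FR(0; 1, ℓ₋₁)` of the j305149 r1 `core_only` minus-A2I⁻ witness: all its cells `[x | c·ℓ₋₁ or O | O | O]` (lower 19, upper 14; `genpos_emit.py` from the LINE 15 `mcellOf` tables). -/
def r1CoreFR01 : Support where
  lower := [cellOf O O O O,
    cellOf O (4, -4, 0) O O,
    cellOf (1, 1, 0) (3, -3, 0) O O,
    cellOf (1, 0, 1) (3, -3, 0) O O,
    cellOf (1, -1, 0) (3, -3, 0) O O,
    cellOf (1, 0, -1) (3, -3, 0) O O,
    cellOf (2, 2, 0) (2, -2, 0) O O,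
    cellOf (2, 0, 2) (2, -2, 0) O O,
    cellOf (2, -2, 0) (2, -2, 0) O O,
    cellOf (2, 0, -2) (2, -2, 0) O O,
    cellOf (3, 3, 0) (1, -1, 0) O O,
    cellOf (3, 0, 3) (1, -1, 0) O O,
    cellOf (3, -3, 0) (1, -1, 0) O O,
    cellOf (3, 0, -3) (1, -1, 0) O O,
    cellOf (4, 4, 0) O O O,
    cellOf (4, 0, 4) O O O,
    cellOf (4, -4, 0) O O O,
    cellOf (4, 0, -4) O O O,
    cellOf (2, 0, 0) (2, -2, 0) O O]
  upper := [cellOf O (3, -3, 0) O O,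
    cellOf (1, 1, 0) (2, -2, 0) O O,
    cellOf (1, 0, 1) (2, -2, 0) O O,
    cellOf (1, -1, 0) (2, -2, 0) O O,
    cellOf (1, 0, -1) (2, -2, 0) O O,
    cellOf (2, 2, 0) (1, -1, 0) O O,
    cellOf (2, 0, 2) (1, -1, 0) O O,
    cellOf (2, -2, 0) (1, -1, 0) O O,
    cellOf (2, 0, -2) (1, -1, 0) O O,
    cellOf (3, 3, 0) O O O,
    cellOf (3, 0, 3) O O O,
    cellOf (3, -3, 0) O O O,
    cellOf (3, 0, -3) O O O,
    cellOf (2, 0, 0) (1, -1, 0) O O]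

/-- the FACTOR-RAY-RAY ideal `FRR(0; 1, ℓ₋₁; 2, ℓ₋ᵢ)` of the same witness: all its cells `[x | c·ℓ₋₁ or O | c′·ℓ₋ᵢ or O | O]` (lower 49, upper 30; 13 lower and 4 upper cells are genuinely THREE-FACTOR). -/
def r1CoreFRR012 : Support where
  lower := [cellOf O O O O,
    cellOf O O (4, 0, -4) O,
    cellOf O (1, -1, 0) (3, 0, -3) O,
    cellOf O (2, -2, 0) (2, 0, -2) O,
    cellOf O (3, -3, 0) (1, 0, -1) O,
    cellOf O (4, -4, 0) O O,
    cellOf (1, 1, 0) O (3, 0, -3) O,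
    cellOf (1, 1, 0) (1, -1, 0) (2, 0, -2) O,
    cellOf (1, 1, 0) (2, -2, 0) (1, 0, -1) O,
    cellOf (1, 1, 0) (3, -3, 0) O O,
    cellOf (1, 0, 1) O (3, 0, -3) O,
    cellOf (1, 0, 1) (1, -1, 0) (2, 0, -2) O,
    cellOf (1, 0, 1) (2, -2, 0) (1, 0, -1) O,
    cellOf (1, 0, 1) (3, -3, 0) O O,
    cellOf (1, -1, 0) O (3, 0, -3) O,
    cellOf (1, -1, 0) (1, -1, 0) (2, 0, -2) O,
    cellOf (1, -1, 0) (2, -2, 0) (1, 0, -1) O,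
    cellOf (1, -1, 0) (3, -3, 0) O O,
    cellOf (1, 0, -1) O (3, 0, -3) O,
    cellOf (1, 0, -1) (1, -1, 0) (2, 0, -2) O,
    cellOf (1, 0, -1) (2, -2, 0) (1, 0, -1) O,
    cellOf (1, 0, -1) (3, -3, 0) O O,
    cellOf (2, 2, 0) O (2, 0, -2) O,
    cellOf (2, 2, 0) (1, -1, 0) (1, 0, -1) O,
    cellOf (2, 2, 0) (2, -2, 0) O O,
    cellOf (2, 0, 2) O (2, 0, -2) O,
    cellOf (2, 0, 2) (1, -1, 0) (1, 0, -1) O,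
    cellOf (2, 0, 2) (2, -2, 0) O O,
    cellOf (2, -2, 0) O (2, 0, -2) O,
    cellOf (2, -2, 0) (1, -1, 0) (1, 0, -1) O,
    cellOf (2, -2, 0) (2, -2, 0) O O,
    cellOf (2, 0, -2) O (2, 0, -2) O,
    cellOf (2, 0, -2) (1, -1, 0) (1, 0, -1) O,
    cellOf (2, 0, -2) (2, -2, 0) O O,
    cellOf (3, 3, 0) O (1, 0, -1) O,
    cellOf (3, 3, 0) (1, -1, 0) O O,
    cellOf (3, 0, 3) O (1, 0, -1) O,
    cellOf (3, 0, 3) (1, -1, 0) O O,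
    cellOf (3, -3, 0) O (1, 0, -1) O,
    cellOf (3, -3, 0) (1, -1, 0) O O,
    cellOf (3, 0, -3) O (1, 0, -1) O,
    cellOf (3, 0, -3) (1, -1, 0) O O,
    cellOf (4, 4, 0) O O O,
    cellOf (4, 0, 4) O O O,
    cellOf (4, -4, 0) O O O,
    cellOf (4, 0, -4) O O O,
    cellOf (2, 0, 0) O (2, 0, -2) O,
    cellOf (2, 0, 0) (1, -1, 0) (1, 0, -1) O,
    cellOf (2, 0, 0) (2, -2, 0) O O]
  upper := [cellOf O O (3, 0, -3) O,
    cellOf O (1, -1, 0) (2, 0, -2) O,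
    cellOf O (2, -2, 0) (1, 0, -1) O,
    cellOf O (3, -3, 0) O O,
    cellOf (1, 1, 0) O (2, 0, -2) O,
    cellOf (1, 1, 0) (1, -1, 0) (1, 0, -1) O,
    cellOf (1, 1, 0) (2, -2, 0) O O,
    cellOf (1, 0, 1) O (2, 0, -2) O,
    cellOf (1, 0, 1) (1, -1, 0) (1, 0, -1) O,
    cellOf (1, 0, 1) (2, -2, 0) O O,
    cellOf (1, -1, 0) O (2, 0, -2) O,
    cellOf (1, -1, 0) (1, -1, 0) (1, 0, -1) O,
    cellOf (1, -1, 0) (2, -2, 0) O O,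
    cellOf (1, 0, -1) O (2, 0, -2) O,
    cellOf (1, 0, -1) (1, -1, 0) (1, 0, -1) O,
    cellOf (1, 0, -1) (2, -2, 0) O O,
    cellOf (2, 2, 0) O (1, 0, -1) O,
    cellOf (2, 2, 0) (1, -1, 0) O O,
    cellOf (2, 0, 2) O (1, 0, -1) O,
    cellOf (2, 0, 2) (1, -1, 0) O O,
    cellOf (2, -2, 0) O (1, 0, -1) O,
    cellOf (2, -2, 0) (1, -1, 0) O O,
    cellOf (2, 0, -2) O (1, 0, -1) O,
    cellOf (2, 0, -2) (1, -1, 0) O O,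
    cellOf (3, 3, 0) O O O,
    cellOf (3, 0, 3) O O O,
    cellOf (3, -3, 0) O O O,
    cellOf (3, 0, -3) O O O,
    cellOf (2, 0, 0) O (1, 0, -1) O,
    cellOf (2, 0, 0) (1, -1, 0) O O]


/-- the ray letters `ℓ₋₁ = (1; −1)` and `ℓ₋ᵢ = (1; −i)` (null directions). -/
def lm1 : Letter := (1, -1, 0)
/-- see `lm1`. -/
def lmi : Letter := (1, 0, -1)

/-- CENSUS (r1 `core_only`, FACTOR-RAY ideal `FR(0; 1, ℓ₋₁)`): 19 lower ∕ 14 upper psd cells, all in the ideal; (B2)⁺ matched except `N[O⁴]`;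
unit reading `¬Heavy` (19 > 14) — a READING of the SAT support, not a violation by a design (§7). -/
theorem r1CoreFR01_census :
    r1CoreFR01.lower.length = 19 ∧ r1CoreFR01.upper.length = 14 ∧
    (∀ X ∈ r1CoreFR01.lower ++ r1CoreFR01.upper, X.Psd ∧ FR 0 1 lm1 X) ∧
    (∀ Y ∈ r1CoreFR01.lower, Y ≠ zeroCell → r1CoreFR01.Matched Y) ∧ ¬ r1CoreFR01.Matched zeroCell ∧
    ¬ r1CoreFR01.Heavy (FR 0 1 lm1) := by
  decide

/-- CENSUS (r1 `core_only`, FACTOR-RAY-RAY ideal `FRR(0; 1, ℓ₋₁; 2, ℓ₋ᵢ)`): 49 lower ∕ 30 upper psd cells, all in the ideal and all COVERED;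
13 lower and 4 upper cells are NOT two-factor (genuinely three-factor — outside §2's law, inside NC₃'s); (B2)⁺ matched except `N[O⁴]`;
unit reading `¬Heavy` (49 > 30). -/
theorem r1CoreFRR012_census :
    r1CoreFRR012.lower.length = 49 ∧ r1CoreFRR012.upper.length = 30 ∧
    (∀ X ∈ r1CoreFRR012.lower ++ r1CoreFRR012.upper, X.Psd ∧ FRR 0 1 2 lm1 lmi X ∧ Covered X) ∧
    (r1CoreFRR012.lower.filter fun X => !decide (TwoFactor X)).length = 13 ∧
    (r1CoreFRR012.upper.filter fun X => !decide (TwoFactor X)).length = 4 ∧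
    (∀ Y ∈ r1CoreFRR012.lower, Y ≠ zeroCell → r1CoreFRR012.Matched Y) ∧ ¬ r1CoreFRR012.Matched zeroCell ∧
    ¬ r1CoreFRR012.Heavy (FRR 0 1 2 lm1 lmi) := by
  decide

/-- Design-level content of the FRR unit reading (§7′ form): any design on this support with lower multiplicities ≥ 1 on the support needs upper
multiplicity mass ≥ 49 on the 30 upper cells of `FRR(0; 1, ℓ₋₁; 2, ℓ₋ᵢ)` — a row no factor-pair ideal sees. -/
theorem r1CoreFRR012_upper_mass' {mN mP : Cell → ℕ} (hN : ∀ X ∈ r1CoreFRR012.lower, 1 ≤ mN X)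
    (h : r1CoreFRR012.HeavyM mN mP (FRR 0 1 2 lm1 lmi)) :
    49 ≤ ((r1CoreFRR012.upper.filter fun X => decide (FRR 0 1 2 lm1 lmi X)).map mP).sum := by
  have := Support.upper_mass_of_heavyM' (FRR 0 1 2 lm1 lmi) hN h
  have hc : r1CoreFRR012.lower.countP (fun X => decide (FRR 0 1 2 lm1 lmi X)) = 49 := by decide
  omega


/-! ## §9 FOUR-RAY BALANCE DICHOTOMY — NC₄ — and the LOCK LAW (rev 1.6; rev 1.7: every `ψ`-invariant `h`; rev 1.8: NC₅ equivariant-curve separation, NC* for all 4-dim quotients; rev 1.9: NC₆ + COMPLETE POSITION THEOREM; rev 1.10: NC₅'s closing clause taken at `h₀`, rider n1)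

THEOREM NC₄ (pencil structure + exact machine certificate, card rev 1.6 § The law; NOT formalised here).  Let `π : P ↠ B′ = Π_f C_{ζ_f}` be a
FOUR-RAY quotient (one ray `C_{ζ_f} = S_f ∕ F_{ζ_f}` per factor, `ζ_f = β_f∕α_f` the phase of the ray letter, `|ζ_f| = 1`), `K = ker π = Π_f F_{ζ_f}`.
Call `(h, π)` BALANCED iff `T₀K ⊥_h ψ(T₀K)`; for a product-type class `h = Σ_f (α_f κ_{A,f} + β_f κ_{B,f})` this reads `α_f |ζ_f|² = β_f` for all `f`,
so at the census class `h₀ = 2Θ` EVERY four-ray quotient of the letter alphabet is balanced (all letters have `|ζ| = 1`).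
(i)  `(h, π)` not balanced ⇒ `Z` dominates `B′` (the eight pairing equations `[Z] ∪ π^*Γ = 0`, `Γ ∈ Λ⁷ π^*H¹(B′)`, force `q = 0`).
(ii) `(h, π)` balanced and `Z ⊂ π⁻¹(D)` for a threefold `D ⊂ B′` ⇒ the class is LOCKED: `w₊ = −4!·2³·Π_f β_f · q ∕ Π_f ζ_f = −192·q·Πβ_f ∕ Πζ_f` in the frame
     `vol₊ = Π_f dz_{A,f} ∧ dz̄_{B,f}` (at `h₀`: `w₊ = −192 q · Π_f ζ̄_f`; in the `Θ`-frame `[Z] = q_Θ Θ⁴ + w`: `w₊ = −12 q_Θ Π_f ζ̄_f`), whence the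
     frame-free identities `w·w = (64∕35)·q²·h⁸` and `35 · (Z·Z) · h⁸ = 99 · (Z·h⁴)²`.
Consequently a hypothetical carrier is in general position with respect to EVERY factor∕ray quotient of dimension ≤ 4 (NC₁–NC₃) except possibly the
four-ray quotients of ONE lock class `Π_f ζ_f = ζ*_Z := −192 q ∕ w₊` (empty unless `|w₊| = 192|q|`), and the (B1)∕(B2) rows extend to every four-ray ideal
outside that class (`CoveredL`).  REV 1.7 (general `h`): a `ψ`-invariant Kähler class is block-diagonal, `h = A ⊕ B` on the `A`- and `B`-coordinates
(`h(x_A, y_B) = h(ψx_A, ψy_B) = −h(x_A, y_B)`); `GL₄(ℂ) × GL₄(ℂ)` acting on the two blocks normalises `A = B = 1` and turns `T₀K = {(−Mx, x)}` into the graph of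
`M′ = S M T⁻¹`, which `U(4) × U(4)` brings to `diag(s_f)`, `s_f > 0` its singular values — the product-type case `α = β = 1`, `ζ_f = s_f`, balanced iff all
`s_f = 1` iff `M′` unitary iff `B = Mᵀ A M̄` iff `T₀K ⊥_h ψT₀K` (`balance_normalForm`); the span `⟨h⁴, vol₊, vol₋⟩` and `U` are carried to themselves (`vol₊`
up to the scalar `det`), so (i), (ii) and the frame-free lock `35·(Z·Z)·h⁸ = 99·(Z·h⁴)²` hold for every `ψ`-invariant Kähler `h` (e.g. every `symH ψ e a` of
STUB R: `symH ψ e a = c·(ι^*H + ψ^*ι^*H)`, `c ∈ ℚ^×`, is `ψ`-invariant because `ψ² = [−1]` acts trivially on `H²`, and is ± a Kähler class; the argument only uses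
`h` up to sign).  NOTE (critic v2, rev 1.8): BALANCE IS PER FACTOR — all singular values `s_f = 1`; `Π_f s_f = 1` does NOT suffice (`s = (2, ½, 1, 1)` is forced) —
whereas `InLockClass` below tests only the PRODUCT phase `Π_f ζ_f`: harmless for the census, where every ray letter has `|ζ_f| = 1` and balance at `h₀` is automatic,
so that only the lock CLASS remains to be tested.
THEOREM NC₅ (rev 1.8, EQUIVARIANT-CURVE SEPARATION; pencil, ANY Kähler class `h`, `ψ`-invariant or not).  Let `π : P ↠ B′ = P∕K` be ANY quotient
(`K` any abelian subvariety, `m := dim B′`) such that `π^*H^{1,0}(B′)` contains a non-zero PURE-`A` form `θ = Σ α_f dz_{A,f}` or a pure-`B` form (`P_A, P_B = E₀⁴` the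
`ψ`-eigen-factors; ⟺ `dim(T₀K ∩ T₀P_B) ≥ 5 − m` resp. `T₀P_A`: AUTOMATIC for `m ≥ 5`; for `m = 4` it reads `T₀K ∩ T₀P_B ≠ 0`, e.g. every quotient keeping a whole
factor or an axis and every `[N_A | N_B]` with a singular block).  Then `dim π(Z) = min(4, m)`.  PROOF: put `m′ = min(4, m)`; if `dim π(Z) ≤ m′ − 1` then
`H^{2m′−1}(π(Z)) = 0`, so `[Z] ∪ Γ = 0` for all `Γ ∈ Λ^{2m′−1}π^*H¹(B′)`; take an `h`-unitary coframe `e₁ = θ∕|θ|`, `e₂, …, e_{m′} ∈ π^*H^{1,0} ∩ θ^⊥`, `…, e₈`, so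
`h = iΣ e_c ē_c`, and `Γ := e₁ē₁ ∧ e₂⋯e_{m′} ∧ ē₂⋯ē_{m′−1}`: `vol₊ ∧ e₁ = 0` (`e₁ ∈ ⟨dz_{A,f}⟩`, all four of which divide `vol₊`), `vol₋ ∧ ē₁ = 0`, while
`h⁴ ∧ Γ = 4!·Σ_{C ⊆ {m′+1..8}, |C| = 4} Π_{c∈C}(i e_c ē_c) ∧ Γ ≠ 0` (distinct monomials; for `m′ = 4` exactly one, `nc5_unique_complement`); so `0 = [Z] ∪ Γ = q·h⁴∧Γ`
forces `q = 0`, i.e. `[Z] = w ∈ W`; but `W ∪ h₀⁴ = 0` for the `ψ`-invariant polarisation `h₀` (bidegree), so `deg_{h₀} Z = 0` — impossible for an effective 4-cycle (rider n1,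
idea-crit-hsem-2 g6: for non-`ψ`-invariant `h` one may have `vol_± · h⁴ ≠ 0`, so the contradiction is taken at `h₀`, not at `h`).  ∎  NC₅ re-proves NC₂∕NC₃ and, with NC₄⁺, gives
THEOREM NC* (every 4-dimensional quotient `P∕K`, `h` `ψ`-invariant): `Z ⊂ π⁻¹(threefold)` ⇒ `T₀K ⊥_h ψ(T₀K)` (which forces `K` transverse to `P_A` and `P_B`)
AND `35·(Z·Z)·h⁸ = 99·(Z·h⁴)²`.
THEOREM NC₆ (rev 1.9, TRANSVERSE LOW QUOTIENTS; pencil, `h` `ψ`-invariant Kähler).  Every quotient `π : P ↠ B′` with `m = dim B′ ∈ {2, 3}` and `K` transverse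
(`rank N_A = rank N_B = m`: no pure-`A`∕`B` form in `π^*H^{1,0}`) is DOMINATED: `dim π(Z) = m`.  PROOF: normal form as in NC₄⁺ — `h`-unitary coframes `a_1..a_4` of `V_A^*`,
`b_1..b_4` of `V_B^*` with `π^*H^{1,0} = ⟨u_j = a_j + s_j b_j⟩_{j ≤ m}`, `s_j > 0` (LQ on `N_A`, SVD on `N_B`), `vol₊ = c₊·a_1⋯a_4 b̄_1⋯b̄_4`, `vol₋ = c₋·ā_1⋯ā_4 b_1⋯b_4`,
`h = iΣ_c (a_c ā_c + b_c b̄_c)`.  If `dim π(Z) ≤ m − 1` then `[Z] ∪ Λ^{j}π^*H¹(B′) = 0` for `j ≥ 2m − 1`; take `Γ := Π_{j ≤ m} u_j ∧ ū_j ∈ Λ^{2m}`.  Against `vol₊` only the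
term `s_j b_j ā_j` of each `u_j ū_j` survives, so `vol₊ ∧ Γ = ±c₊(Πs_j)·M₊` with `M₊` the monomial omitting exactly `{ā_c, b_c : c > m}`; `vol₋ ∧ Γ = ±c₋(Πs_j)·M₋`, `M₋` omitting
`{a_c, b̄_c : c > m}`; but `h⁴ = 4!·Σ_{|C|=4} Π_{c∈C}(pair_c)` uses FULL pairs and `Γ` no covector of index `> m`, so every monomial of `h⁴ ∧ Γ` contains, for each `c > m`, both or
neither of `a_c, ā_c` (and of `b_c, b̄_c`) — its `M_±`-coefficients vanish.  Hence `w₊ = w₋ = 0`, and then `q·h⁴ ∧ Γ = 0` with `h⁴ ∧ Γ ≠ 0` (the monomial omitting `{ā_1, b_1}` — and,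
for `m = 2`, one chosen full pair of index `> 2` — has coefficient `± 4!·s_1·Π_{1<j≤m}(1 + s_j²) ≠ 0`) forces `q = 0` — contradiction.  ∎  (Machine: `ncrank_probe10.py`, 24∕24 random diagonal weights
forced with `Λ^{2m−1}` alone; `ncrank_probe8.py` 60∕60 random skew types at `h₀`.)
COMPLETE POSITION THEOREM (rev 1.9 = NC₁ + NC₅ + NC₆ + NC₄⁺; `h` `ψ`-invariant Kähler, in particular every `symH ψ e a` of STUB R).  For a hypothetical carrier `Z` and EVERY
quotient `π : P ↠ B′`: `dim π(Z) = min(4, dim B′)`, EXCEPT possibly when `dim B′ = 4`, `K` is transverse AND `h`-balanced (`T₀K ⊥_h ψT₀K`); there `dim π(Z) ∈ {3, 4}` and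
`dim π(Z) = 3` forces the LOCK `35·(Z·Z)·h⁸ = 99·(Z·h⁴)²` (one class up to sign; at `h₀` on the letter rays: the class `Πζ_f = ζ*`).
Certificate rows: `ncrank_probe7.py` (13 hand types + 24 random rank-deficient: all FORCED except the transverse unitary ones,
silent with lock `±192`), `ncrank_probe8.py` (skew quotients of dimension 2, 3: 60∕60 dominated), `ncrank_probe9.py` (NC₅ types FORCED under fully general `h`).
Below: the typed census shadow and the exact arithmetic; the exterior-algebra certificate is `code∕ncrank*.py` (logs cited in the card; the real singular-value
family is `ncrank_probe6.py`).  HC ∕ HC_CM ∕ HC_AV ∕ H2 ∕ 18881 are NOT proved; a law about the position and class of a HYPOTHETICAL carrier is not a seed. -/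

section LockLaw

/-- Gaussian-integer multiplication on `ℤ × ℤ = (re, im)`. -/
def gmul (z w : ℤ × ℤ) : ℤ × ℤ := (z.1 * w.1 - z.2 * w.2, z.1 * w.2 + z.2 * w.1)

/-- `β = (Re β, Im β)` of a letter. -/
def Letter.beta (x : Letter) : ℤ × ℤ := (x.2.1, x.2.2)

/-- `Π_f β_f` (Gaussian integer). -/
def Cell.betaProd (X : Cell) : ℤ × ℤ := gmul (gmul (gmul (X 0).beta (X 1).beta) (X 2).beta) (X 3).beta

/-- `Π_f α_f`. -/
def Cell.alphaProd (X : Cell) : ℤ := (X 0).a * (X 1).a * (X 2).a * (X 3).a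

/-- FOUR-RAY cell: every letter is a ray letter (Hermitian rank 1); its principal downset is pulled back from the four-ray quotient `Π_f C_{ζ_f}`,
`ζ_f = β_f ∕ α_f`.  These are exactly the cells NOT `Covered` among cells of Hermitian rank ≤ 4 (`fourRay_iff_not_covered_of_hrank_le_four`). -/
def Cell.FourRay (X : Cell) : Prop := (X 0).hrank = 1 ∧ (X 1).hrank = 1 ∧ (X 2).hrank = 1 ∧ (X 3).hrank = 1

instance (X : Cell) : Decidable X.FourRay := by unfold Cell.FourRay; infer_instance

/-- LOCK CLASS `ζ*`: the phase product `Π_f ζ_f = Π_f β_f ∕ Π_f α_f` equals `ζ* = (u_re + i u_im) ∕ u_a`, the lock phase written as a letter-like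
triple `u = (u_a, u_re, u_im)` (cross-multiplied, so no division): `u_a · Π β = (Π α) · (u_re + i u_im)`. -/
def Cell.InLockClass (u : Letter) (X : Cell) : Prop :=
  u.a * X.betaProd.1 = X.alphaProd * u.2.1 ∧ u.a * X.betaProd.2 = X.alphaProd * u.2.2

instance (u : Letter) (X : Cell) : Decidable (X.InLockClass u) := by unfold Cell.InLockClass; infer_instance

/-- `CoveredL lock Y` (rev 1.6): `Y` is `Covered` (NC₁–NC₃), or `Y` is a four-ray cell outside the lock class — `lock = none` encodes a carrier class with
`|w₊| ≠ 192|q|` (no exceptional class: every four-ray quotient is dominated), `lock = some u` the lock phase `ζ* = u`. -/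
def CoveredL : Option Letter → Cell → Prop
  | none, Y => Covered Y ∨ Y.FourRay
  | some u, Y => Covered Y ∨ (Y.FourRay ∧ ¬ Y.InLockClass u)

instance (l : Option Letter) (Y : Cell) : Decidable (CoveredL l Y) := by
  cases l <;> unfold CoveredL <;> infer_instance

theorem coveredL_of_covered (l : Option Letter) (Y : Cell) (h : Covered Y) : CoveredL l Y := by
  cases l <;> exact Or.inl h

/-- (B2)ᴸ MATCHING LAW of rev 1.6: every lower cell that is `CoveredL` is matched. -/
def Support.MatchingLawL (l : Option Letter) (S : Support) : Prop := ∀ Y ∈ S.lower, CoveredL l Y → S.Matched Y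

theorem Support.matchingLawGP_of_matchingLawL (l : Option Letter) (S : Support) (h : S.MatchingLawL l) : S.MatchingLawGP :=
  fun Y hY hc => h Y hY (coveredL_of_covered l Y hc)

/-- A four-ray cell has Hermitian rank exactly 4 and is not `Covered`; conversely an uncovered cell of rank ≤ 4 is four-ray. -/
theorem fourRay_iff_not_covered_of_hrank_le_four (Y : Cell) (h4 : Y.hrank ≤ 4) : Y.FourRay ↔ ¬ Covered Y := by
  have hr : ∀ x : Letter, x.hrank ≤ 2 := by
    intro x; unfold Letter.hrank; split_ifs <;> omega
  have e := Cell.hrank_eq_sum Y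
  constructor
  · rintro ⟨h0, h1, h2, h3⟩ ⟨f, hf⟩
    have h4' : Y.hrank = 4 := by unfold Cell.hrank; omega
    have hf1 : (Y f).hrank = 1 := by
      fin_cases f
      · exact h0
      · exact h1
      · exact h2
      · exact h3
    omega
  · intro hnc
    unfold Covered at hnc
    push Not at hnc
    have g0 := hnc 0; have g1 := hnc 1; have g2 := hnc 2; have g3 := hnc 3
    have := hr (Y 0); have := hr (Y 1); have := hr (Y 2); have := hr (Y 3)
    unfold Cell.hrank at h4 g0 g1 g2 g3
    refine ⟨?_, ?_, ?_, ?_⟩ <;> omega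

/-- the lock phases `ζ* ∈ {1, i, −1, −i}` as letter-like triples. -/
def lockOne : Letter := (1, 1, 0)
/-- see `lockOne`. -/
def lockI : Letter := (1, 0, 1)

/-- the 52 four-ray (uncovered) lower cells of the r1 `core_only` witness (json 9107d080715f00f4), with multiplicity. -/
def r1CoreFourRay : List Cell := [
  cellOf (1, 1, 0) (1, 1, 0) (1, 1, 0) (1, 1, 0),
  cellOf (1, 1, 0) (1, 1, 0) (1, 0, 1) (1, 0, -1),
  cellOf (1, 1, 0) (1, 1, 0) (1, 0, -1) (1, 0, 1),
  cellOf (1, 1, 0) (1, 0, 1) (1, 1, 0) (1, 0, -1),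
  cellOf (1, 1, 0) (1, 0, 1) (1, 0, 1) (1, -1, 0),
  cellOf (1, 1, 0) (1, 0, 1) (1, -1, 0) (1, 0, 1),
  cellOf (1, 1, 0) (1, 0, 1) (1, 0, -1) (1, 1, 0),
  cellOf (1, 1, 0) (1, -1, 0) (1, 0, 1) (1, 0, 1),
  cellOf (1, 1, 0) (1, -1, 0) (1, 0, -1) (1, 0, -1),
  cellOf (1, 1, 0) (1, 0, -1) (1, 1, 0) (1, 0, 1),
  cellOf (1, 1, 0) (1, 0, -1) (1, 0, 1) (1, 1, 0),
  cellOf (1, 1, 0) (1, 0, -1) (1, -1, 0) (1, 0, -1),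
  cellOf (1, 1, 0) (1, 0, -1) (1, 0, -1) (1, -1, 0),
  cellOf (1, 0, 1) (1, 1, 0) (1, 1, 0) (1, 0, -1),
  cellOf (1, 0, 1) (1, 1, 0) (1, 0, 1) (1, -1, 0),
  cellOf (1, 0, 1) (1, 1, 0) (1, -1, 0) (1, 0, 1),
  cellOf (1, 0, 1) (1, 1, 0) (1, 0, -1) (1, 1, 0),
  cellOf (1, 0, 1) (1, 0, 1) (1, 1, 0) (1, -1, 0),
  cellOf (1, 0, 1) (1, 0, 1) (1, 0, 1) (1, 0, 1),
  cellOf (1, 0, 1) (1, 0, 1) (1, -1, 0) (1, 1, 0),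
  cellOf (1, 0, 1) (1, -1, 0) (1, 1, 0) (1, 0, 1),
  cellOf (1, 0, 1) (1, -1, 0) (1, 0, 1) (1, 1, 0),
  cellOf (1, 0, 1) (1, -1, 0) (1, -1, 0) (1, 0, -1),
  cellOf (1, 0, 1) (1, -1, 0) (1, 0, -1) (1, -1, 0),
  cellOf (1, 0, 1) (1, 0, -1) (1, 1, 0) (1, 1, 0),
  cellOf (1, 0, 1) (1, 0, -1) (1, -1, 0) (1, -1, 0),
  cellOf (1, -1, 0) (1, 1, 0) (1, 0, 1) (1, 0, 1),
  cellOf (1, -1, 0) (1, 1, 0) (1, 0, -1) (1, 0, -1),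
  cellOf (1, -1, 0) (1, 0, 1) (1, 1, 0) (1, 0, 1),
  cellOf (1, -1, 0) (1, 0, 1) (1, 0, 1) (1, 1, 0),
  cellOf (1, -1, 0) (1, 0, 1) (1, -1, 0) (1, 0, -1),
  cellOf (1, -1, 0) (1, 0, 1) (1, 0, -1) (1, -1, 0),
  cellOf (1, -1, 0) (1, -1, 0) (1, 0, 1) (1, 0, -1),
  cellOf (1, -1, 0) (1, -1, 0) (1, -1, 0) (1, -1, 0),
  cellOf (1, -1, 0) (1, -1, 0) (1, 0, -1) (1, 0, 1),
  cellOf (1, -1, 0) (1, 0, -1) (1, 1, 0) (1, 0, -1),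
  cellOf (1, -1, 0) (1, 0, -1) (1, 0, 1) (1, -1, 0),
  cellOf (1, -1, 0) (1, 0, -1) (1, -1, 0) (1, 0, 1),
  cellOf (1, -1, 0) (1, 0, -1) (1, 0, -1) (1, 1, 0),
  cellOf (1, 0, -1) (1, 1, 0) (1, 1, 0) (1, 0, 1),
  cellOf (1, 0, -1) (1, 1, 0) (1, 0, 1) (1, 1, 0),
  cellOf (1, 0, -1) (1, 1, 0) (1, -1, 0) (1, 0, -1),
  cellOf (1, 0, -1) (1, 1, 0) (1, 0, -1) (1, -1, 0),
  cellOf (1, 0, -1) (1, 0, 1) (1, 1, 0) (1, 1, 0),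
  cellOf (1, 0, -1) (1, 0, 1) (1, -1, 0) (1, -1, 0),
  cellOf (1, 0, -1) (1, -1, 0) (1, 1, 0) (1, 0, -1),
  cellOf (1, 0, -1) (1, -1, 0) (1, 0, 1) (1, -1, 0),
  cellOf (1, 0, -1) (1, -1, 0) (1, -1, 0) (1, 0, 1),
  cellOf (1, 0, -1) (1, -1, 0) (1, 0, -1) (1, 1, 0),
  cellOf (1, 0, -1) (1, 0, -1) (1, 1, 0) (1, -1, 0),
  cellOf (1, 0, -1) (1, 0, -1) (1, -1, 0) (1, 1, 0),
  cellOf (1, 0, -1) (1, 0, -1) (1, 0, -1) (1, 0, -1)]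

/-- CENSUS (r1 `core_only`, READINGS of a SAT support): the 52 uncovered cells are four-ray, psd, of Hermitian rank 4, NOT `Covered`, and lie in the SINGLE
lock class `Π ζ_f = 1` (none in the classes `i`, `−1`, `−i`); hence for a carrier class with lock phase `ζ* ≠ 1` — or with `|w₊| ≠ 192|q|` — ALL 1 227
lower cells of the witness are `CoveredL` (1 175 `Covered` by §8's count + these 52). -/
theorem r1CoreFourRay_census :
    r1CoreFourRay.length = 52 ∧
    (∀ X ∈ r1CoreFourRay, X.Psd ∧ X.FourRay ∧ X.hrank = 4 ∧ ¬ Covered X ∧ X.InLockClass lockOne ∧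
      ¬ X.InLockClass lockI ∧ ¬ X.InLockClass lm1 ∧ ¬ X.InLockClass lmi) ∧
    (∀ X ∈ r1CoreFourRay, CoveredL none X ∧ CoveredL (some lockI) X ∧ CoveredL (some lm1) X ∧ CoveredL (some lmi) X ∧
      ¬ CoveredL (some lockOne) X) := by
  refine ⟨by decide, ?_, ?_⟩ <;> decide

/-! ### The exact arithmetic of NC₄ (product-type `h`): pair consistency ⟺ balance; the universal lock ratios -/

/-- The two pairing equations at factor `f` (omit `u_f`, resp. `ū_f`, from the basis of `Λ⁷U`) read
`ŵ = −k·q·ζ̄_f·α_f·P ∕ R` and `ŵ = −k·q·β_f·P ∕ (R·ζ_f)` with `k = 4!`, `P = Π_{g ≠ f}(β_g + α_g|ζ_g|²) ≠ 0`, `R = Π_{g ≠ f} ζ_g ≠ 0`;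
their difference factors through the BALANCE defect `α_f ζ_f ζ̄_f − β_f`. -/
theorem lock_pair_diff {K : Type*} [Field K] (k q α β ζ ζb P R : K) (hζ : ζ ≠ 0) (hR : R ≠ 0) :
    -(k * q * ζb * α * P / R) - -(k * q * β * P / (R * ζ)) = -(k * q * P / (R * ζ)) * (α * (ζ * ζb) - β) := by
  field_simp
  ring

/-- BALANCE: the two equations at factor `f` are consistent iff `α_f |ζ_f|² = β_f` (all the scalars being non-zero). -/
theorem balance_iff {K : Type*} [Field K] (k q α β ζ ζb P R : K) (hk : k ≠ 0) (hq : q ≠ 0) (hP : P ≠ 0) (hζ : ζ ≠ 0) (hR : R ≠ 0) :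
    -(k * q * ζb * α * P / R) = -(k * q * β * P / (R * ζ)) ↔ α * (ζ * ζb) = β := by
  rw [← sub_eq_zero, lock_pair_diff k q α β ζ ζb P R hζ hR, mul_eq_zero, sub_eq_zero, neg_eq_zero]
  have hne : k * q * P / (R * ζ) ≠ 0 := div_ne_zero (mul_ne_zero (mul_ne_zero hk hq) hP) (mul_ne_zero hR hζ)
  simp [hne]

/-- Under balance the (f,1)-equations give the SAME `ŵ` for every `f`: `β_f · Π_{g≠f} 2β_g = Π_g 2β_g ∕ 2 · 2`, here for four factors explicitly. -/
theorem lock_value_independent (β₀ β₁ β₂ β₃ : ℚ) :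
    β₀ * ((2 * β₁) * (2 * β₂) * (2 * β₃)) = β₁ * ((2 * β₀) * (2 * β₂) * (2 * β₃)) ∧
    β₀ * ((2 * β₁) * (2 * β₂) * (2 * β₃)) = 8 * (β₀ * β₁ * β₂ * β₃) := by
  constructor <;> ring

/-- `k · Π_g (2β_g)` at `k = 4!`, `β = 1`: the lock modulus `192 = 4! · 2³`; in the `Θ`-frame (`h₀ = 2Θ`, `h₀⁴ = 16 Θ⁴`) it is `12`. -/
theorem lock_modulus : Nat.factorial 4 * 2 ^ 3 = 192 ∧ (192 : ℚ) / 16 = 12 := by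
  refine ⟨by decide, by norm_num⟩

/-- The combinatorial heart of NC₅ (rev 1.8): among the 4-subsets of the eight coframe PAIRS `{e_c, ē_c}`, exactly one avoids the four pairs
touched by `Γ = e₁ē₁e₂e₃e₄ē₂ē₃` — so `h⁴ ∧ Γ` is a single non-zero monomial. -/
theorem nc5_unique_complement :
    ((Finset.univ : Finset (Fin 8)).powersetCard 4).filter (fun C => Disjoint C ({0, 1, 2, 3} : Finset (Fin 8))) = {({4, 5, 6, 7} : Finset (Fin 8))} := by
  decide

/-- NORMAL FORM of the balance condition (rev 1.7): after `A = B = 1` the quotient matrix is `diag(s_f)`, `s_f > 0`, i.e. the product-type data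
`α_f = β_f = 1`, `ζ_f = s_f`; BALANCED `α_f ζ_f ζ̄_f = β_f` reads `s_f² = 1`, i.e. `s_f = 1` (all singular values one ⇔ the normalised matrix is unitary
⇔ `T₀K ⊥_h ψT₀K`). -/
theorem balance_normalForm (s : ℝ) (hs : 0 < s) : (1 : ℝ) * (s * s) = 1 ↔ s = 1 := by
  constructor
  · intro h
    nlinarith [h, hs]
  · rintro rfl
    norm_num

/-- UNIVERSAL LOCK RATIO (every `ψ`-invariant Kähler `h`, rev 1.7; pencil formula in the product frame, invariant under the normalising coordinate change):
`w·w ∕ (q h⁴)² = 2·|w₊|²·∫vol₊vol₋ ∕ (q²·∫h⁸) = 2·(4!)²·Π(2β_g)²·Πα_gβ_g^{-1}… = 2·192²∕8! = 64∕35`, for any common positive weight factor `W`. -/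
theorem lock_ratio (W : ℚ) (hW : W ≠ 0) : (2 * 192 ^ 2 * W) / (Nat.factorial 8 * W) = 64 / 35 := by
  have h8 : (Nat.factorial 8 : ℚ) = 40320 := by norm_num [Nat.factorial]
  rw [h8]
  field_simp
  norm_num

/-- … hence `Z·Z = (1 + 64∕35)·q²·h⁸ = (99∕35)·q²h⁸`, i.e. `35·(Z·Z)·h⁸ = 99·(Z·h⁴)²` (as `Z·h⁴ = q·h⁸`). -/
theorem lock_selfIntersection (q H8 ZZ Zh4 : ℚ) (hdeg : Zh4 = q * H8) (hZZ : ZZ = q ^ 2 * H8 + 64 / 35 * (q ^ 2 * H8)) :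
    35 * ZZ * H8 = 99 * Zh4 ^ 2 := by
  subst hdeg; subst hZZ; ring

end LockLaw

end Summit.HodgeConjecture.HodgeConjecture.Cruxes.BlochSeedDiscOne.NonConfinementLaw
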